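import Literature.Claims.NS.Zhirkin2016
import Literature.Claims.NS.Fathi2025
import Literature.Claims.NS.Qiao2021
import Literature.Claims.NS.Reed2026
import Literature.Claims.NS.Bachani2026
import Literature.Claims.NS.Dou2026b
import Literature.Claims.NS.Qin2026
import Literature.Claims.NS.Khedr2017
import Literature.Claims.NS.Harbeck2025
import Literature.Claims.NS.Bazarbekov2020
import Literature.Claims.NS.Faliush2026
import Literature.Claims.NS.Wayman2026
import Literature.Claims.NS.Otelbaev2013
import Literature.Claims.NS.Nguyen2022
import Literature.Claims.NS.Zhong2026
import Literature.Claims.NS.Chishtie2025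
import Literature.Analysis.FluidPDE.VorticityCalculus
import Literature.Analysis.FluidPDE.VectorCalculusProofs
import Literature.Analysis.FluidPDE.TaoEnstrophyLocalisation
import Literature.Barriers.NavierStokesRegularity.AbstractAPrioriEstimateDirectSumProofs
import Literature.Analysis.FluidPDE.TorusNSSobolevControlLifespan
import Literature.Analysis.FluidPDE.TorusNSVectorFieldGevrey
import Literature.Analysis.FunctionSpaces.TorusVectorParseval
import Literature.Analysis.FluidPDE.TorusABCFlow
import Literature.Analysis.FluidPDE.TorusClassicalHnBalance
import Literature.Analysis.FunctionSpaces.TorusTestFunction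
import Mathlib.Analysis.SpecialFunctions.ExpDeriv
import Mathlib.Analysis.SpecialFunctions.Trigonometric.Inverse
import Literature.Analysis.FluidPDE.NSQuasipotential
import Literature.Analysis.FluidPDE.NSSuitableESSRefutation
import Mathlib.Analysis.SpecialFunctions.SmoothTransition
import HarnessLib

/-!
# Discharges of typed inference chains whose antecedent is kernel-refuted (`Literature/Claims/NS/`)

The ns-claims typists record a printed inference «Step A, Step B ⟹ Step C» as a named `Prop`
`def Step_C_of : Prop := Step_A → Step_B → Step_C` when the inference itself is the locus of doubt.
Such a `Prop` is nevertheless TRUE — vacuously — as soon as one antecedent is false, and for the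
chains below an antecedent HAS been refuted in the kernel, summit-side, by the cell's refuters
(`Summits/NavierStokesRegularity/…/Theorems/SoloRefute*.lean`, which a `Literature` file cannot
import), privately in the typed file itself, or in a Literature barrier file.  This leaf re-proves
(where needed) the refutation as a PUBLIC Literature-side twin (same witness as the summit-side theorem, credited in each docstring)
and lands `theorem <Decl>_holds : <Decl>` for the chain (D-0026 in-file-style discharge; every
statement unchanged; theorems only, no `def`, no new named fact).

What each `_holds` below says is ONLY that the typed composition carries no content once the named
antecedent is dead — it is NOT the printed inference succeeding, and it implies no verdict on any
claim beyond the refuted step (the cell's `SoloRefute*` theorems remain the locators of record).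
The pattern is the cell's own: cf. `Zhirkin2016.step5_holds` («holds — VACUOUSLY»).

Contents (fact discharged ← antecedent refuted, twin of):
* `Zhirkin2016.Composes_holds` ← `Zhirkin2016.step4_nonlinearVanishes_false`
  (file-private `not_step4`; summit-side `…Theorems.Zhirkin2016.not_Step4_nonlinearVanishes`);
* `Fathi2025.Step42_inference_holds` ← `Fathi2025.step42_close_false`
  (summit-side `…Theorems.Fathi2025.not_Step42_close`);
* `Qiao2021.Step_5c_holds` ← `Qiao2021.step_5b_false` (summit-side `…Theorems.Qiao2021.not_Step_5b`);
* `Reed2026.Step_bridgeClay_holds` ← `Reed2026.claimedTheorem_false`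
  (summit-side `…Theorems.Reed2026.not_ClaimedTheorem`);
* `Bachani2026.Step_9_of_L62_holds` ← `Bachani2026.step_L62_false`
  (summit-side `…Theorems.Bachani2026.not_Step_L62`);
* `Dou2026b.Step8a_inference_holds` ← `Dou2026b.step6_EVMP_false`
  (summit-side `…Theorems.Dou2026b.not_Step6_EVMP`, plane Couette flow);
* `Qin2026.Step8_inference_holds` ← `Qin2026.step31_i_false`
  (summit-side `…Theorems.Qin2026.not_Step31_i`, the printed circles intersect);
* `Khedr2017.Step_uniqProof_holds` ← `Khedr2017.eigenRepAll_false`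
  (summit-side `…Theorems.Khedr2017.not_EigenRepAll`, rigid rotation);
* `Harbeck2025.Step_IXtoMain_holds` ← `Harbeck2025.step_osgood_false` and
  `Harbeck2025.Step_R3ext_holds` ← `Harbeck2025.claimedTheoremT3_false`
  (summit-side `…Theorems.Harbeck2025.not_Step_osgood` / `not_ClaimedTheoremT3`, viscous ABC flow);
* `Bazarbekov2020.Step3_LeraySchauder_holds` and `Bazarbekov2020.Step4_Section4_holds` ←
  `Bazarbekov2020.step2_Theorem31_false` (summit-side `…Theorems.Bazarbekov2020.not_Step2_Theorem31`,
  the Abel–Volterra witness `w = 4 + (128/3)·min(|t|^{3/8},1)`, `f ≡ 8`);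
* `Faliush2026.Step_Cor1_inf_holds` ← `Faliush2026.step_L1a_false` (summit-side
  `…Theorems.Faliush2026.not_Step_L1a`, the transversal single-mode heat flow) and
  `Faliush2026.Step_closure_holds` ← `Faliush2026.step_L1b_false` (summit-side
  `…Theorems.Faliush2026.not_Step_L1b`, one high Fourier mode);
* `Wayman2026.Step_Prop14_holds` ← `Wayman2026.thm13_asPrinted_false` (summit-side
  `…Theorems.Wayman2026.not_Thm13_asPrinted`, the viscous shear/Beltrami wave on `T³(a*)`);
* `Otelbaev2013.Theorem2_of_Theorem62_holds` ← the EXISTING Literature-side refutation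
  `Literature.Barriers.NavierStokesRegularity.not_otelbaev2013_theorem62` (nothing re-proved);
* `Nguyen2022.Step6_Section4_holds` ← `Nguyen2022.step5_Theorem301_false` (summit-side
  `…Theorems.Nguyen2022.not_Step5_Theorem301`, the self-similar field `a(t)w(c(t)x)`);
* `Zhong2026.Step_27_of_loc_holds` ← `Zhong2026.step_geom_ge_loc_false` (summit-side
  `…Theorems.Zhong2026.not_Step_geom_ge_loc`, witness A: localised planar shear).

WHAT THIS IS NOT: not a claim about NS regularity or blow-up; not a claim about any author beyond
the typed locators.
-/

noncomputable section

open Set Filter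
open scoped ContDiff Topology ENNReal Laplacian InnerProductSpace

/-! ### Zhirkin 2016 — `Composes` (§4 p.20), antecedent Step 4 ((39) p.8) -/

namespace Literature.Claims.NS.Zhirkin2016

open Literature.Analysis.FluidPDE in
/-- **Step 4 is false** («(v·∇)v ≡ 0 on smooth divergence-free fields», (39) p.8): for the ABC
field `v = abc 1 1 1` the first component of `((v·∇)v)(0)` is `1`.  Public twin of the file-private
`not_step4` and of the summit-side `…Theorems.Zhirkin2016.not_Step4_nonlinearVanishes` (same
witness). [cite: Zhirkin2016, §2.4 eq. (39) p.8] -/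
theorem step4_nonlinearVanishes_false : ¬ Step4_nonlinearVanishes := by
  intro h4
  have h := h4 (ABC.abc 1 1 1) (ABC.contDiff_abc 1 1 1) (fun x => ABC.isDivFree_abc 1 1 1 x) 0
  have hv : ABC.abc 1 1 1 (0 : EuclideanSpace ℝ (Fin 3)) =
      EuclideanSpace.single (0 : Fin 3) (1 : ℝ) + EuclideanSpace.single (1 : Fin 3) (1 : ℝ) +
        EuclideanSpace.single (2 : Fin 3) (1 : ℝ) := by
    ext i
    fin_cases i <;> simp
  have hc := congrArg (fun v : EuclideanSpace ℝ (Fin 3) => v 0) h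
  simp only [convect] at hc
  rw [hv, map_add, map_add] at hc
  simp only [PiLp.add_apply, ABC.fderiv_abc_single, PiLp.zero_apply] at hc
  simp [ABC.jac] at hc

/-- **`Composes` holds — VACUOUSLY** (typed `Prop` unchanged): the chain
`Step1 → Step2 → Step3 → Step4 → Step5 → Step6 → ClaimedTheorem` is true as an implication because
its fourth antecedent is false (`step4_nonlinearVanishes_false`).  NOT the printed §4 inference
succeeding: the file's record stands (the steps that hold entail Clay (A), `clayA_of_step3_step6` /
`clayA_of_step4_step5`, the opposite of `ClaimedTheorem`'s first conjunct).
[cite: Zhirkin2016, §4 p.20 ¶1–2] -/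
theorem Composes_holds : Composes := fun _ _ _ h4 _ _ => (step4_nonlinearVanishes_false h4).elim

end Literature.Claims.NS.Zhirkin2016

/-! ### Fathi 2025 — `Step42_inference` (§4.2 p.5), antecedent `Step42_close` -/

namespace Literature.Claims.NS.Fathi2025

/-- **`Step42_close` is false as typed** («for EVERY K ≥ K₀ the bootstrap E₀ + C_s K√K T + F ≤ K
closes»): at `(E₀, C_s, T, F) = (0, 1, 1, 0)` and `K = max K₀ 4 ≥ 4` one has `K√K ≥ 2K > K`.
Twin of the summit-side `…Theorems.Fathi2025.not_Step42_close` (same witness).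
[cite: Fathi2025, §4.2 p.5 l.34–45] -/
theorem step42_close_false : ¬ Step42_close := by
  intro h
  obtain ⟨K₀, hK⟩ := h 0 1 1 0 le_rfl one_pos one_pos le_rfl
  have hK4 : (4 : ℝ) ≤ max K₀ 4 := le_max_right _ _
  have h2 : (2 : ℝ) ≤ Real.sqrt (max K₀ 4) := by
    have h4 : Real.sqrt 4 = (2 : ℝ) := by
      rw [show (4 : ℝ) = 2 ^ 2 by norm_num, Real.sqrt_sq (by norm_num)]
    rw [← h4]
    exact Real.sqrt_le_sqrt hK4
  have hle := hK (max K₀ 4) (le_max_left _ _)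
  nlinarith [hK4, h2, hle]

/-- **`Step42_inference` holds — VACUOUSLY** (typed `Prop` unchanged): the inference
`Step42_cubic → Step42_close → (H³ stays bounded on [0,T))` is true as an implication because its
second antecedent is false (`step42_close_false`).  NOT the printed §4.2 bootstrap succeeding (it
closes only for small data / short time, as the typist's flag says). [cite: Fathi2025, §4.2 p.5 l.24–45] -/
theorem Step42_inference_holds : Step42_inference := fun _ h _ => (step42_close_false h).elim

end Literature.Claims.NS.Fathi2025

/-! ### Qiao 2021/22 — `Step_5c` (proof of Thm 5.1 p.23), antecedent `Step_5b` -/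

namespace Literature.Claims.NS.Qiao2021

/-- **`Step_5b` is false** (the time shift: a series restarted at `T/2` says nothing about
negative times): `f(t) = expNegInvGlue(−t)` is smooth and vanishes on `[0, ∞)`, so the ZERO series
sums to `f` on `[0,1]` and converges at `t = −1`, yet `f(−1) = expNegInvGlue 1 > 0`.  Twin of the
summit-side `…Theorems.Qiao2021.not_Step_5b` (same witness).
[cite: QiaoYanyou2022, proof of Thm 5.1 p. 23, (5.1)–(5.3)] -/
theorem step_5b_false : ¬ Step_5b := by
  intro h
  have hf : ContDiff ℝ ∞ (fun t : ℝ => expNegInvGlue (-t)) := expNegInvGlue.contDiff.comp contDiff_neg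
  have hser : ∀ t ∈ Icc (0 : ℝ) 1, HasSum (fun n : ℕ => (0 : ℝ) * t ^ n) (expNegInvGlue (-t)) := by
    intro t ht
    rw [expNegInvGlue.zero_of_nonpos (by linarith [ht.1])]
    simp
  have hsum : Summable (fun n : ℕ => (0 : ℝ) * (-1 : ℝ) ^ n) := by
    simp
  have hS := h (fun _ => 0) (fun t => expNegInvGlue (-t)) 1 (-1) one_pos (by norm_num) hf hser hsum
  have hzero : HasSum (fun n : ℕ => (0 : ℝ) * (-1 : ℝ) ^ n) 0 := by
    simp
  have heq : expNegInvGlue (-(-1 : ℝ)) = 0 := hS.unique hzero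
  have hpos : 0 < expNegInvGlue (-(-1 : ℝ)) := expNegInvGlue.pos_of_pos (by norm_num)
  linarith

/-- **`Step_5c` holds — VACUOUSLY** (typed `Prop` unchanged): the chain
`Step_33 → Step_41 → Lemma_51 → Step_5a → Step_5b → ClaimedTheorem` is true as an implication
because its fifth antecedent is false (`step_5b_false`; the fourth, `Step_5a`, is refuted
summit-side as well).  NOT the printed p.23 assembly succeeding.
[cite: QiaoYanyou2022, proof of Thm 5.1 p. 23] -/
theorem Step_5c_holds : Step_5c := fun _ _ _ _ h5b => (step_5b_false h5b).elim

end Literature.Claims.NS.Qiao2021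

/-! ### Reed 2026 — `Step_bridgeClay` (§6 p.18), antecedent `ClaimedTheorem` («S = ∅») -/

namespace Literature.Claims.NS.Reed2026

/-- **«S = ∅» is false at the deposit's own grain**: the fluid at rest `u ≡ 0`, `p ≡ 0` in the
closed first octant (a right-angle corner domain), with corner point `(1, 0, 0)`, satisfies the
deposit's steady system for `ν = 1`, the no-slip condition, and is a `GlobalSmoothSolution`
(a differentiable field).  Twin of the summit-side `…Theorems.Reed2026.not_ClaimedTheorem` (same
witness, inlined without auxiliary definitions). [cite: Reed2026, §6 p.18 (first sentence), abstract p.1] -/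
theorem claimedTheorem_false : ¬ ClaimedTheorem := by
  intro h
  -- the rest state and the zero pressure, as terms
  have hdu : ∀ q : Point3D, fderiv ℝ (fun _ : Point3D => ((0 : ℝ), (0 : ℝ), (0 : ℝ))) q = 0 :=
    fun q => (hasFDerivAt_const ((0 : ℝ), (0 : ℝ), (0 : ℝ)) q).fderiv
  have hdp : ∀ q : Point3D, fderiv ℝ (fun _ : Point3D => (0 : ℝ)) q = 0 :=
    fun q => (hasFDerivAt_const (0 : ℝ) q).fderiv
  have hPDE : FullNavierStokesPDE (fun _ : Point3D => ((0 : ℝ), (0 : ℝ), (0 : ℝ)))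
      (fun _ : Point3D => (0 : ℝ)) 1 := by
    refine ⟨fun q => ?_, fun q => ?_⟩
    · simp [Divergence, VelocityGradient, hdu]
    · simp [AdvectiveTerm, PressureGradient, ViscousLaplacian, hdp, Prod.mk_zero_zero]
  have hΩ : IsRightAngleCornerDomain {q : Point3D | q.1 ≥ 0 ∧ q.2.1 ≥ 0 ∧ q.2.2 ≥ 0} :=
    ⟨0, 0, 0, fun _ => Iff.rfl⟩
  have hS : GlobalSmoothSolution (fun _ : Point3D => ((0 : ℝ), (0 : ℝ), (0 : ℝ))) :=
    (globalSmoothSolution_iff _).mpr (differentiable_const ((0 : ℝ), (0 : ℝ), (0 : ℝ)))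
  exact h {q : Point3D | q.1 ≥ 0 ∧ q.2.1 ≥ 0 ∧ q.2.2 ≥ 0} (1, 0, 0)
    (fun _ : Point3D => ((0 : ℝ), (0 : ℝ), (0 : ℝ))) (fun _ : Point3D => (0 : ℝ)) 1 hPDE hΩ one_pos
    rfl hS

/-- **`Step_bridgeClay` holds — VACUOUSLY** (typed `Prop` unchanged): the bridge
`ClaimedTheorem → ClayVariants.clayR3.Breakdown` is true as an implication because its antecedent
«S = ∅» is false at its own grain (`claimedTheorem_false`).  NOT the printed §6 inference
succeeding, and no statement about Fefferman's (C). [cite: Reed2026, §6 p.18 (first sentence), abstract p.1] -/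
theorem Step_bridgeClay_holds : Step_bridgeClay := fun h => (claimedTheorem_false h).elim

end Literature.Claims.NS.Reed2026

/-! ### Bachani 2026 — `Step_9_of_L62` (Thm 7.1 proof (9) p.9), antecedent Lemma 6.2 -/

namespace Literature.Claims.NS.Bachani2026

open MeasureTheory Literature.Analysis.FluidPDE

/-- `D(0) = 0` on `E3`. [folklore] -/
private theorem fderiv_zero_apply' (x : E3) : fderiv ℝ (0 : E3 → E3) x = 0 :=
  (hasFDerivAt_const (0 : E3) x).fderiv

/-- `∫ |0|² = 0`. [folklore] -/
private theorem lintegral_enorm_sq_zero' : (∫⁻ x, ‖(0 : E3 → E3) x‖ₑ ^ 2) = 0 := by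
  have h0 : (fun x => ‖(0 : E3 → E3) x‖ₑ ^ 2) = fun _ => 0 := by
    funext x
    rw [Pi.zero_apply, ← ofReal_norm, norm_zero, ENNReal.ofReal_zero, zero_pow two_ne_zero]
  rw [h0, lintegral_zero]

/-- **The rest state** `u ≡ 0`, `p ≡ 0` is a solution of the typed class on `[0,T)` from the
datum `0`, for every `ν` and `T` (twin of the summit-side `…Theorems.Bachani2026.isSol_rest`). [folklore] -/
private theorem isSol_rest' (ν T : ℝ) : IsSol ν 0 T 0 0 where
  datum := by
    refine ⟨contDiff_const, fun x => ?_, ?_, ?_⟩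
    · rw [NSWave0.divergence, fderiv_zero_apply']; simp
    · rw [lintegral_enorm_sq_zero']; exact ENNReal.zero_lt_top
    · have h1 : (fun x => ‖fderiv ℝ (0 : E3 → E3) x‖ₑ ^ 2) = fun _ => 0 := by
        funext x
        rw [fderiv_zero_apply', ← ofReal_norm, norm_zero, ENNReal.ofReal_zero,
          zero_pow two_ne_zero]
      rw [h1, lintegral_zero]; exact ENNReal.zero_lt_top
  classical := isClassicalNSSolutionOn_zero (Ico 0 T) ν
  initial := rfl
  energy := ⟨0, ENNReal.zero_lt_top, fun _ _ => (lintegral_enorm_sq_zero').le⟩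

/-- The vorticity of the rest state vanishes. [folklore] -/
private theorem curl_zero' : curl (0 : E3 → E3) = 0 := by
  funext y
  ext i
  fin_cases i <;> simp [curl, fderiv_zero_apply']

/-- `Sᵣ(t) = 0` along the rest state. [folklore] -/
private theorem St_rest' (ρ : Mollifier) (r t : ℝ) : St ρ r (0 : ℝ → E3 → E3) t = 0 := by
  show globEntropy ρ r (curl ((0 : ℝ → E3 → E3) t)) = 0
  have : ∀ x, eweight ρ r (curl (0 : E3 → E3)) x = 0 := fun x => by rw [eweight, curl_zero']; simp
  simp [globEntropy, this]

/-- `dSᵣ/dt = 0` along the rest state. [folklore] -/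
private theorem dSdt_rest' (ρ : Mollifier) (r T t : ℝ) : dSdt ρ r T (0 : ℝ → E3 → E3) t = 0 := by
  have hfun : (fun s : ℝ => globEntropyR ρ r (curl ((0 : ℝ → E3 → E3) s))) =
      Function.const ℝ (globEntropyR ρ r (curl (0 : E3 → E3))) := rfl
  rw [dSdt, hfun, derivWithin_const]
  rfl

/-- **Lemma 6.2 is false as typed** (the «quantitative entropy barrier»): along the rest state —
a smooth finite-enstrophy solution of the typed class — `S_{r*} = 0 ≤ c*` while `dS_{r*}/dt = 0`
is not `> 0`; at the standard mollifier and `ν = 1`.  Twin of the summit-side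
`…Theorems.Bachani2026.not_Step_L62` (same witness). [cite: Bachani2026, Lemma 6.2 p.7 l.22–39, p.8 l.3–4] -/
theorem step_L62_false : ¬ Step_L62 := by
  intro h
  obtain ⟨rs, cs, _, _, H⟩ := h stdMollifier 1 one_pos
  have h1 := H 0 1 0 0 (isSol_rest' 1 1) 0 ⟨le_rfl, one_pos⟩ (by rw [St_rest']; exact bot_le)
  rw [dSdt_rest'] at h1
  exact lt_irrefl 0 h1

/-- **`Step_9_of_L62` holds — VACUOUSLY** (typed `Prop` unchanged): the inference
`Step_L62 → Step_L33iii → Step_9` is true as an implication because its first antecedent,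
Lemma 6.2, is false as typed (`step_L62_false`).  NOT the printed Thm 7.1 (9) inference
succeeding (`Step_9` itself is refuted summit-side at the rest state).
[cite: Bachani2026, Thm 7.1 proof (9) p.9 l.9; Lemma 6.2 p.7–8; Lemma 3.3 (iii) p.4] -/
theorem Step_9_of_L62_holds : Step_9_of_L62 := fun h _ => (step_L62_false h).elim

end Literature.Claims.NS.Bachani2026

/-! ### Dou 2026b — `Step8a_inference` (Thm 6.1 proof item 1 p.11), antecedent EVMP (Thm 5.3) -/

namespace Literature.Claims.NS.Dou2026b

open Literature.Analysis.FluidPDE in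
/-- **EVMP (Theorem 5.3, in the generality its proof argues) is false**: plane Couette flow
`u(x) = x₁ e₀` (a continuous linear map `L` with `L ∘ L = 0`, `tr L = 0`) is a steady classical
Navier–Stokes solution with zero pressure and force; at `x = e₁` one has `u ≠ 0`, `∂ₜu = 0` and
`νΔu + ⟨f,τ⟩τ = 0`, yet `u(e₁) = e₀ ≠ 0`.  Twin of the summit-side `…Theorems.Dou2026b.not_Step6_EVMP`
(same witness, the shear written inline as a term). [cite: Dou2026b, Theorem 5.3 eqs. (28)–(33) print p.9–10] -/
theorem step6_EVMP_false : ¬ Step6_EVMP := by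
  intro h6
  -- plane Couette shear `L x = x₁ e₀`
  set L : EuclideanSpace ℝ (Fin 3) →L[ℝ] EuclideanSpace ℝ (Fin 3) :=
    (EuclideanSpace.proj (1 : Fin 3)).smulRight (EuclideanSpace.single (0 : Fin 3) (1 : ℝ)) with hL
  have L_apply : ∀ x : EuclideanSpace ℝ (Fin 3),
      L x = x 1 • EuclideanSpace.single (0 : Fin 3) (1 : ℝ) := fun x => rfl
  have L_sq : ∀ x : EuclideanSpace ℝ (Fin 3), L (L x) = 0 := by
    intro x
    rw [L_apply, L_apply, PiLp.smul_apply]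
    simp
  have L_div : VectorCalculus.IsDivFree (L : EuclideanSpace ℝ (Fin 3) → EuclideanSpace ℝ (Fin 3)) := by
    intro x
    rw [divergence_clm_apply, LinearMap.trace_eq_sum_inner _ (EuclideanSpace.basisFun (Fin 3) ℝ)]
    simp [Fin.sum_univ_three, L_apply, EuclideanSpace.inner_single_left]
  have L_e1 : L (EuclideanSpace.single (1 : Fin 3) (1 : ℝ)) ≠ 0 := by
    rw [L_apply]
    intro h
    have := congrArg (fun v : EuclideanSpace ℝ (Fin 3) => v 0) h
    simp at this
  -- Couette flow is a steady classical solution on every time set (zero pressure, zero force)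
  have hsol : IsClassicalNSSolutionOn Set.univ 1 (fun _ _ => (0 : EuclideanSpace ℝ (Fin 3)))
      (fun _ => (L : EuclideanSpace ℝ (Fin 3) → EuclideanSpace ℝ (Fin 3))) (fun _ _ => (0 : ℝ)) :=
    { smooth_velocity := (contDiff_uncurry_const_clm L).contDiffOn
      smooth_pressure := contDiffOn_const
      momentum := by
        intro t _ x
        rw [timeDerivWithin, derivWithin_fun_const, convect_clm_apply, L_sq, laplacian_clm_apply,
          smul_zero, gradient_fun_const]
        simp
      divFree := fun _ _ => L_div }
  refine L_e1 (h6 Set.univ 1 _ _ _ one_pos hsol 0 (Set.mem_univ _)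
    (EuclideanSpace.single (1 : Fin 3) (1 : ℝ)) L_e1 ?_ ?_)
  · rw [timeDerivWithin, derivWithin_fun_const]; rfl
  · rw [laplacian_clm_apply, smul_zero, inner_zero_left, zero_smul, add_zero]

/-- **`Step8a_inference` holds — VACUOUSLY** (typed `Prop` unchanged): `Step6_EVMP → LocalVanishing`
is true as an implication because EVMP is false (`step6_EVMP_false`) — exactly as the typist's
docstring anticipated («vacuously true once EVMP is refuted»).  NOT the printed item-1 inference
succeeding: `LocalVanishing` is itself refuted summit-side by the same Couette flow.
[cite: Dou2026b, Theorem 6.1 proof item 1 print p.11] -/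
theorem Step8a_inference_holds : Step8a_inference := fun h6 => (step6_EVMP_false h6).elim

end Literature.Claims.NS.Dou2026b

/-! ### Qin 2026 — `Step8_inference` (Thm 11.1 proof summary p.31–32), antecedent Lemma 3.1 (i) -/

namespace Literature.Claims.NS.Qin2026

open Real in
/-- `γ₁(arccos c) = γ₂(arcsin c)` for `c = d/R ∈ [−1,1]`, `R ≠ 0`: the common point
`(d, R√(1−c²), d)` of the printed centerlines (13). Twin of the summit-side
`…Theorems.Qin2026.gam1_meets_gam2`. [cite: Qin2026, Construction 3.1 (13) p.12 l.32–41] -/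
theorem gam1_meets_gam2' (R d : ℝ) (hR : R ≠ 0) (h1 : -1 ≤ d / R) (h2 : d / R ≤ 1) :
    gam1 R d (arccos (d / R)) = gam2 R d (arcsin (d / R)) := by
  unfold gam1 gam2
  rw [cos_arccos h1 h2, sin_arccos, sin_arcsin h1 h2, cos_arcsin, mul_div_cancel₀ _ hR]

/-- The printed ratio `d₀/R = 16/10⁴` (`R = 10⁴ρ₀`, `d₀ = 16ρ₀`, `ρ₀ ≠ 0`). Twin of the summit-side
`…Theorems.Qin2026.d0_div_Rof`. [cite: Qin2026, Def 3.7 p.14 l.2–11] -/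
theorem d0_div_Rof' (ρ₀ : ℝ) (hρ : ρ₀ ≠ 0) : d0 ρ₀ / Rof ρ₀ = 16 / 10 ^ 4 := by
  unfold d0 Rof alpha
  exact mul_div_mul_right _ _ hρ

open Real in
/-- **Lemma 3.1 (i) is false at the printed parameters** ((13) / Def 3.7): at `ρ₀ = 1` the circles
`γ₁`, `γ₂` meet at `θ = arccos(16/10⁴)`, `ϕ = arcsin(16/10⁴)`, so `dist = 0 < 16 = d̄`.  Twin of the
summit-side `…Theorems.Qin2026.not_Step31_i` (same witness). [cite: Qin2026, Lemma 3.1 (i) p.12 l.42–52; (13) p.12 l.32–41] -/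
theorem step31_i_false : ¬ Step31_i := by
  intro h
  have hc1 : -1 ≤ d0 1 / Rof 1 := by rw [d0_div_Rof' 1 one_ne_zero]; norm_num
  have hc2 : d0 1 / Rof 1 ≤ 1 := by rw [d0_div_Rof' 1 one_ne_zero]; norm_num
  have hR : Rof 1 ≠ 0 := by unfold Rof; norm_num
  have h16 := (h 1 one_pos (arccos (d0 1 / Rof 1)) (arcsin (d0 1 / Rof 1))).1
  rw [gam1_meets_gam2' (Rof 1) (d0 1) hR hc1 hc2, dist_self] at h16
  have : (0 : ℝ) < d0 1 := by unfold d0 alpha; norm_num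
  linarith

/-- **`Step8_inference` holds — VACUOUSLY** (typed `Prop` unchanged): the chain
`Step31_i → Step58 → Step82_59 → Step8_out` is true as an implication because its first antecedent,
Lemma 3.1 (i) at the printed parameters, is false (`step31_i_false`; the third, `Step82_59`, is
refuted summit-side as well).  NOT the printed proof summary succeeding; the author's un-displayed
«suitably chosen fibers» (`Step31_charitable`) are not addressed.
[cite: Qin2026, Thm 11.1 Proof Summary p.31 l.50 – p.32 l.25] -/
theorem Step8_inference_holds : Step8_inference := fun h _ _ => (step31_i_false h).elim

end Literature.Claims.NS.Qin2026

/-! ### Khedr 2017 — `Step_uniqProof` (Uniqueness theorem l.257–300), antecedent `EigenRepAll` -/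

namespace Literature.Claims.NS.Khedr2017

open Literature.Analysis.FluidPDE in
/-- **`EigenRepSelf` is false** («∇V V = λ_V V», Lemma l.188–192): for the rigid rotation
`V x = (x₁, −x₀, 0)` (a continuous linear map `R`), `DV(e₀)[V e₀] = R (R e₀) = −e₀` while
`V e₀ = −e₁`; no scalar `λ` has `−e₀ = λ • (−e₁)` (compare the `0`-th components).  Twin of the
summit-side `…Theorems.Khedr2017.not_EigenRepSelf` (same witness, the rotation written inline
as a term). [cite: Khedr2017, Lemma l.188–192] -/
theorem eigenRepSelf_false : ¬ EigenRepSelf := by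
  intro H
  set R : E3 →L[ℝ] E3 :=
    (EuclideanSpace.proj (1 : Fin 3) : E3 →L[ℝ] ℝ).smulRight (EuclideanSpace.single 0 (1 : ℝ)) -
      (EuclideanSpace.proj (0 : Fin 3) : E3 →L[ℝ] ℝ).smulRight (EuclideanSpace.single 1 (1 : ℝ))
    with hR
  have R_apply : ∀ x : E3,
      R x = (x 1) • EuclideanSpace.single 0 (1 : ℝ) - (x 0) • EuclideanSpace.single 1 (1 : ℝ) := by
    intro x
    simp [hR]
  obtain ⟨lam, hlam⟩ := H (fun x => R x) R.contDiff
  have h := hlam (EuclideanSpace.single 0 (1 : ℝ))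
  rw [R.fderiv] at h
  have h0 := congrArg (fun v : E3 => v 0) h
  simp [R_apply] at h0

/-- **`EigenRepAll` is false** (the form used at l.270–290: one scalar `λ_W` for every vector) —
it contains `EigenRepSelf` (`eigenRepSelf_of_all`). Twin of the summit-side
`…Theorems.Khedr2017.not_EigenRepAll`. [cite: Khedr2017, proof of Theorem (Uniqueness) l.270–290] -/
theorem eigenRepAll_false : ¬ EigenRepAll := fun h => eigenRepSelf_false (eigenRepSelf_of_all h)

/-- **`Step_uniqProof` holds — VACUOUSLY** (typed `Prop` unchanged): `EigenRepAll → ClaimedTheorem`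
is true as an implication because `EigenRepAll` is false (`eigenRepAll_false`).  NOT the printed
uniqueness proof succeeding: `ClaimedTheorem` is refuted summit-side (solid-body rotation in a
ball). [cite: Khedr2017, proof of Theorem (Uniqueness) l.261–300] -/
theorem Step_uniqProof_holds : Step_uniqProof := fun h => (eigenRepAll_false h).elim

end Literature.Claims.NS.Khedr2017

/-! ### Harbeck 2025 — `Step_IXtoMain` (Steps IX–X p.330) and `Step_R3ext` (§1.3.2 p.21),
antecedents `Step_osgood` ((1.17) p.20) and Theorem 1.1 as printed -/

namespace Literature.Claims.NS.Harbeck2025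

open MeasureTheory Literature.Analysis.FunctionSpaces Literature.Analysis.FluidPDE
open scoped RealInnerProductSpace

/-- `‖∇(abcFlow)‖₂² = 4π²(A² + B² + C²)` (first Laplacian shell). Twin of the summit-side
`…Theorems.Harbeck2025.gradNormSq_abcFlow`. [cite: MajdaBertozziCUP2002, §2.3.2 Example 2.8] -/
private theorem gradNormSq_abcFlow' (A B C : ℝ) :
    Torus.gradNormSq (Torus.abcFlow A B C) = 4 * Real.pi ^ 2 * (A ^ 2 + B ^ 2 + C ^ 2) := by
  have h := Torus.integral_inner_laplacian_self_eq_neg_gradNormSq (Torus.isSmooth_abcFlow A B C)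
  have h2 : ∫ x, ⟪Torus.laplacian (Torus.abcFlow A B C) x, Torus.abcFlow A B C x⟫ =
      -(4 * Real.pi ^ 2) * ∫ x, ‖Torus.abcFlow A B C x‖ ^ 2 := by
    rw [← integral_const_mul]
    refine integral_congr_ae (ae_of_all _ fun x => ?_)
    dsimp only
    rw [Torus.laplacian_abcFlow, inner_neg_left, real_inner_smul_left, real_inner_self_eq_norm_sq]
    ring
  rw [h2, Torus.integral_norm_sq_abcFlow] at h
  linarith

/-- `‖∇(c • w)‖₂² = c² ‖∇w‖₂²` for smooth `w`. [folklore] -/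
private theorem gradNormSq_const_smul' {w : UnitAddTorus (Fin 3) → EuclideanSpace ℝ (Fin 3)}
    (hw : Torus.IsSmooth w) (c : ℝ) :
    Torus.gradNormSq (c • w) = c ^ 2 * Torus.gradNormSq w := by
  unfold Torus.gradNormSq
  rw [← integral_const_mul]
  refine integral_congr_ae (ae_of_all _ fun x => ?_)
  dsimp only
  rw [Finset.mul_sum]
  refine Finset.sum_congr rfl fun i _ => ?_
  rw [Torus.partialDeriv_const_smul (hw.isContDiff (by norm_cast)) c i, Pi.smul_apply,
    norm_smul, mul_pow, Real.norm_eq_abs, sq_abs]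

/-- `‖u(t)‖²_{H¹} = (1 + 4π²)(A² + B² + C²) · e^{−8π²t}` along the viscous ABC flow at `ν = 1`, the
slice written as in `Torus.isClassicalNSSolutionOn_abcFlow 1`. Twin of the summit-side
`…Theorems.Harbeck2025.h1NormSq_abcNS` (no auxiliary definition).
[cite: MajdaBertozziCUP2002, §2.3.2 Example 2.8] -/
private theorem h1NormSq_abc' (A B C t : ℝ) :
    h1NormSq (fun x => Real.exp (-(1 * (2 * Real.pi) ^ 2) * t) • Torus.abcFlow A B C x) =
      (1 + 4 * Real.pi ^ 2) * (A ^ 2 + B ^ 2 + C ^ 2) * Real.exp (-(8 * Real.pi ^ 2) * t) := by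
  set c : ℝ := Real.exp (-(1 * (2 * Real.pi) ^ 2) * t) with hc
  have hslice : (fun x => c • Torus.abcFlow A B C x) = c • Torus.abcFlow A B C := by
    funext x; rfl
  have hc2 : c ^ 2 = Real.exp (-(8 * Real.pi ^ 2) * t) := by
    rw [hc, ← Real.exp_nat_mul]; congr 1; push_cast; ring
  unfold h1NormSq
  rw [hslice, gradNormSq_const_smul' (Torus.isSmooth_abcFlow A B C) c, gradNormSq_abcFlow']
  have hL2 : ∫ x, ‖(c • Torus.abcFlow A B C) x‖ ^ 2 = c ^ 2 * (A ^ 2 + B ^ 2 + C ^ 2) := by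
    rw [← Torus.integral_norm_sq_abcFlow A B C, ← integral_const_mul]
    refine integral_congr_ae (ae_of_all _ fun x => ?_)
    dsimp only
    rw [Pi.smul_apply, norm_smul, mul_pow, Real.norm_eq_abs, sq_abs]
  rw [hL2, hc2]
  ring

/-- The derivative of the `H¹` history: `d/dt (K e^{−8π²t}) = −8π² K e^{−8π²t}`. [folklore] -/
private theorem deriv_h1NormSq_abc' (A B C t : ℝ) :
    deriv (fun s => h1NormSq (fun x => Real.exp (-(1 * (2 * Real.pi) ^ 2) * s) • Torus.abcFlow A B C x)) t =
      -(8 * Real.pi ^ 2) *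
        ((1 + 4 * Real.pi ^ 2) * (A ^ 2 + B ^ 2 + C ^ 2) * Real.exp (-(8 * Real.pi ^ 2) * t)) := by
  have hfun : (fun s => h1NormSq (fun x => Real.exp (-(1 * (2 * Real.pi) ^ 2) * s) • Torus.abcFlow A B C x)) =
      fun s => (1 + 4 * Real.pi ^ 2) * (A ^ 2 + B ^ 2 + C ^ 2) * Real.exp (-(8 * Real.pi ^ 2) * s) := by
    funext s; exact h1NormSq_abc' A B C s
  rw [hfun]
  have hd : HasDerivAt (fun s => (1 + 4 * Real.pi ^ 2) * (A ^ 2 + B ^ 2 + C ^ 2) *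
      Real.exp (-(8 * Real.pi ^ 2) * s))
      ((1 + 4 * Real.pi ^ 2) * (A ^ 2 + B ^ 2 + C ^ 2) *
        (Real.exp (-(8 * Real.pi ^ 2) * t) * (-(8 * Real.pi ^ 2)))) t := by
    have h1 : HasDerivAt (fun s => -(8 * Real.pi ^ 2) * s) (-(8 * Real.pi ^ 2)) t := by
      simpa using (hasDerivAt_id t).const_mul (-(8 * Real.pi ^ 2))
    exact (h1.exp).const_mul _
  rw [hd.deriv]
  ring

/-- **Step IX / (1.17) is false** (the a-priori Osgood decay law): at `ν = 1`, whatever `γ > 0`, the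
viscous ABC solution with `A = B = C = a := exp(8π²/γ + 4π²)` violates
`d/dt‖u‖²_{H¹} ≤ −γ‖u‖²_{H¹} log(e + ‖u‖_{H¹})` at `t = 1`: the left side is `−8π²·X`, the right
side `−γ X log(e + √X)` with `√X ≥ exp(8π²/γ)`, i.e. `γ log(e + √X) > 8π²`.  Twin of the
summit-side `…Theorems.Harbeck2025.not_Step_osgood` (same witness, no auxiliary definitions).
[cite: Harbeck2025, Theorem 1.1 (1.17) p.20; Step IX p.330] -/
theorem step_osgood_false : ¬ Step_osgood := by
  intro h
  obtain ⟨γ, hγ, hall⟩ := h 1 one_pos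
  set a : ℝ := Real.exp (8 * Real.pi ^ 2 / γ + 4 * Real.pi ^ 2) with ha
  have hdecay := hall _ _ (Torus.isClassicalNSSolutionOn_abcFlow 1 a a a) (by
    have h0 : (fun x : T3 => Real.exp (-(1 * (2 * Real.pi) ^ 2) * 0) • Torus.abcFlow a a a x) =
        Torus.abcFlow a a a := by
      funext x; simp
    show Torus.HasZeroMean (fun x : T3 => Real.exp (-(1 * (2 * Real.pi) ^ 2) * 0) • Torus.abcFlow a a a x)
    rw [h0]
    exact Torus.hasZeroMean_abcFlow a a a) 1 one_pos
  have hd' := deriv_h1NormSq_abc' a a a 1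
  have hn' := h1NormSq_abc' a a a 1
  simp only [] at hdecay hd' hn'
  rw [hd', hn'] at hdecay
  -- abbreviate X = K e^{-8π²} and L = log(e + √X)
  set X : ℝ := (1 + 4 * Real.pi ^ 2) * (a ^ 2 + a ^ 2 + a ^ 2) * Real.exp (-(8 * Real.pi ^ 2) * 1)
    with hX
  set L : ℝ := Real.log (Real.exp 1 + Real.sqrt X) with hL
  have hpi : 0 < Real.pi ^ 2 := by positivity
  have ha2 : a ^ 2 = Real.exp (16 * Real.pi ^ 2 / γ + 8 * Real.pi ^ 2) := by
    rw [ha, ← Real.exp_nat_mul]; congr 1; push_cast; ring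
  have hXval : X = 3 * (1 + 4 * Real.pi ^ 2) * Real.exp (16 * Real.pi ^ 2 / γ) := by
    have hee : Real.exp (16 * Real.pi ^ 2 / γ + 8 * Real.pi ^ 2) * Real.exp (-(8 * Real.pi ^ 2) * 1) =
        Real.exp (16 * Real.pi ^ 2 / γ) := by
      rw [← Real.exp_add]; congr 1; ring
    rw [hX, show (1 + 4 * Real.pi ^ 2) * (a ^ 2 + a ^ 2 + a ^ 2) = 3 * (1 + 4 * Real.pi ^ 2) * a ^ 2 by
      ring, ha2, mul_assoc, hee]
  have hXpos : 0 < X := by rw [hXval]; positivity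
  -- (exp(8π²/γ))² ≤ X, hence exp(8π²/γ) ≤ √X
  have hsq : Real.exp (8 * Real.pi ^ 2 / γ) ^ 2 ≤ X := by
    have h3 : (1 : ℝ) ≤ 3 * (1 + 4 * Real.pi ^ 2) := by nlinarith
    have hexp : Real.exp (8 * Real.pi ^ 2 / γ) ^ 2 = Real.exp (16 * Real.pi ^ 2 / γ) := by
      rw [← Real.exp_nat_mul]; congr 1; push_cast; ring
    rw [hexp, hXval]
    calc Real.exp (16 * Real.pi ^ 2 / γ) = 1 * Real.exp (16 * Real.pi ^ 2 / γ) := (one_mul _).symm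
      _ ≤ 3 * (1 + 4 * Real.pi ^ 2) * Real.exp (16 * Real.pi ^ 2 / γ) :=
        mul_le_mul_of_nonneg_right h3 (Real.exp_pos _).le
  have hsqrt : Real.exp (8 * Real.pi ^ 2 / γ) ≤ Real.sqrt X :=
    calc Real.exp (8 * Real.pi ^ 2 / γ) = Real.sqrt (Real.exp (8 * Real.pi ^ 2 / γ) ^ 2) :=
        (Real.sqrt_sq (Real.exp_pos _).le).symm
      _ ≤ Real.sqrt X := Real.sqrt_le_sqrt hsq
  -- log(e + √X) > 8π²/γ, so γ L > 8π²
  have hlog : 8 * Real.pi ^ 2 / γ < L := by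
    have h1 : 8 * Real.pi ^ 2 / γ ≤ Real.log (Real.sqrt X) := by
      rw [← Real.log_exp (8 * Real.pi ^ 2 / γ)]
      exact Real.log_le_log (Real.exp_pos _) hsqrt
    have h2 : Real.log (Real.sqrt X) < L :=
      Real.log_lt_log (lt_of_lt_of_le (Real.exp_pos _) hsqrt) (by linarith [Real.exp_pos (1 : ℝ)])
    exact lt_of_le_of_lt h1 h2
  have hγL : 8 * Real.pi ^ 2 < γ * L := by
    have h1 := mul_lt_mul_of_pos_left hlog hγ
    have h2 : γ * (8 * Real.pi ^ 2 / γ) = 8 * Real.pi ^ 2 := by field_simp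
    linarith
  -- the printed inequality reads  -8π²·X ≤ -(γ·X·L); but 8π²·X < γ·X·L
  have key : γ * X * L ≤ 8 * Real.pi ^ 2 * X := by linarith
  have key2 : 8 * Real.pi ^ 2 * X < γ * X * L := by
    have h1 := mul_lt_mul_of_pos_right hγL hXpos
    have h2 : γ * L * X = γ * X * L := by ring
    linarith
  exact absurd key (not_le.2 key2)

/-- **`Step_IXtoMain` holds — VACUOUSLY** (typed `Prop` unchanged): `Step_osgood → ClaimedTheoremT3`
is true as an implication because the a-priori decay law is false (`step_osgood_false`).  NOT the
printed Steps IX–X inference succeeding: `ClaimedTheoremT3` is false too (`claimedTheoremT3_false`).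
[cite: Harbeck2025, Theorem 1.1 (1.17) p.20; Step IX p.330] -/
theorem Step_IXtoMain_holds : Step_IXtoMain := fun h => (step_osgood_false h).elim

/-- **Theorem 1.1 as printed (with (1.17)) is false** — uniqueness transport in the typed skeleton
(`not_claimedT3_of_not_osgood`). Twin of the summit-side `…Theorems.Harbeck2025.not_ClaimedTheoremT3`.
[cite: Harbeck2025, Theorem 1.1 p.20] -/
theorem claimedTheoremT3_false : ¬ ClaimedTheoremT3 := not_claimedT3_of_not_osgood step_osgood_false

/-- **`Step_R3ext` holds — VACUOUSLY** (typed `Prop` unchanged): `ClaimedTheoremT3 → ClaimedTheoremR3`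
is true as an implication because Theorem 1.1 as printed is false (`claimedTheoremT3_false`).  NOT
the printed §1.3.2 extension succeeding, and no statement about Theorem 1.4 / the Clay grain.
[cite: Harbeck2025, Theorem 1.1 p.20] -/
theorem Step_R3ext_holds : Step_R3ext := fun h => (claimedTheoremT3_false h).elim

end Literature.Claims.NS.Harbeck2025

/-! ### Bazarbekov 2020 — `Step3_LeraySchauder` (Lemma 3.4 / proof of Thm 2.1) and `Step4_Section4`
(§4), antecedent Theorem 3.1 as printed -/

namespace Literature.Claims.NS.Bazarbekov2020

open MeasureTheory intervalIntegral

/-! The witness `w(t) = 4 + (128/3)·min(|t|^{3/8}, 1)` (`= 4 + (128/3) t^{3/8}` on `(0,1]`) and the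
forcing size `f ≡ 8`, written inline (no auxiliary definitions); twins of the summit-side lemmas. -/

/-- `w` is continuous. [folklore] -/
private theorem wit_continuous' :
    Continuous fun t : ℝ => 4 + 128 / 3 * min (|t| ^ (3 / 8 : ℝ)) 1 :=
  continuous_const.add (continuous_const.mul
    (((Real.continuous_rpow_const (by norm_num)).comp continuous_abs).min continuous_const))

/-- `4 ≤ w`. [folklore] -/
private theorem four_le_wit' (t : ℝ) : 4 ≤ 4 + 128 / 3 * min (|t| ^ (3 / 8 : ℝ)) 1 := by
  have h : 0 ≤ min (|t| ^ (3 / 8 : ℝ)) 1 := le_min (Real.rpow_nonneg (abs_nonneg t) _) zero_le_one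
  nlinarith

/-- `0 ≤ w`. [folklore] -/
private theorem wit_nonneg' (t : ℝ) : 0 ≤ 4 + 128 / 3 * min (|t| ^ (3 / 8 : ℝ)) 1 :=
  le_trans (by norm_num) (four_le_wit' t)

/-- `w ≤ 4 + 128/3`. [folklore] -/
private theorem wit_le' (t : ℝ) : 4 + 128 / 3 * min (|t| ^ (3 / 8 : ℝ)) 1 ≤ 4 + 128 / 3 := by
  have h : min (|t| ^ (3 / 8 : ℝ)) 1 ≤ 1 := min_le_right _ _
  nlinarith

/-- On `(0,1]`: `w(t) = 4 + (128/3) t^{3/8}`. [folklore] -/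
private theorem wit_eq' {t : ℝ} (ht : t ∈ Ioc (0 : ℝ) 1) :
    4 + 128 / 3 * min (|t| ^ (3 / 8 : ℝ)) 1 = 4 + 128 / 3 * t ^ (3 / 8 : ℝ) := by
  rw [abs_of_pos ht.1, min_eq_left (Real.rpow_le_one ht.1.le ht.2 (by norm_num))]

/-- On `(0,1]`: `(128/3) t ≤ w(t)` (since `t ≤ t^{3/8}` there). [folklore] -/
private theorem K_mul_le_wit' {t : ℝ} (ht : t ∈ Ioc (0 : ℝ) 1) :
    128 / 3 * t ≤ 4 + 128 / 3 * min (|t| ^ (3 / 8 : ℝ)) 1 := by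
  rw [wit_eq' ht]
  have h1 : t ≤ t ^ (3 / 8 : ℝ) := by
    have := Real.rpow_le_rpow_of_exponent_ge ht.1 ht.2 (show (3 / 8 : ℝ) ≤ 1 by norm_num)
    rwa [Real.rpow_one] at this
  nlinarith

/-- `w²` is integrable on `(0,1)`. [folklore] -/
private theorem wit_sq_integrableOn' :
    IntegrableOn (fun t : ℝ => (4 + 128 / 3 * min (|t| ^ (3 / 8 : ℝ)) 1) ^ 2) (Ioo (0 : ℝ) 1) :=
  ((wit_continuous'.pow 2).integrableOn_Icc (a := 0) (b := 1)).mono_set Ioo_subset_Icc_self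

/-- The Abel kernel `(t − τ)^{−5/8}` is interval-integrable on `[0,t]`. [folklore] -/
private theorem kernel_intervalIntegrable' (t : ℝ) :
    IntervalIntegrable (fun τ => (t - τ) ^ (-(5 / 8) : ℝ)) volume 0 t := by
  have h := (intervalIntegral.intervalIntegrable_rpow' (a := t) (b := 0)
    (show (-1 : ℝ) < -(5 / 8) by norm_num)).comp_sub_left t
  simpa using h

/-- The kernel is integrable on `(0,t)`. [folklore] -/
private theorem kernel_integrableOn' {t : ℝ} (ht : 0 < t) :
    IntegrableOn (fun τ => (t - τ) ^ (-(5 / 8) : ℝ)) (Ioo 0 t) :=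
  (((intervalIntegrable_iff_integrableOn_Ioc_of_le ht.le).mp (kernel_intervalIntegrable' t)).mono_set
    Ioo_subset_Ioc_self)

/-- `∫₀ᵗ (t − τ)^{−5/8} dτ = t^{3/8}/(3/8)`. [folklore] -/
private theorem kernel_integral' {t : ℝ} (ht : 0 < t) :
    ∫ τ in Ioo 0 t, (t - τ) ^ (-(5 / 8) : ℝ) = t ^ (3 / 8 : ℝ) / (3 / 8 : ℝ) := by
  rw [← integral_Ioc_eq_integral_Ioo, ← intervalIntegral.integral_of_le ht.le,
    intervalIntegral.integral_comp_sub_left (fun x => x ^ (-(5 / 8) : ℝ)) t, sub_self, sub_zero,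
    integral_rpow (Or.inl (by norm_num))]
  have h : (-(5 / 8) : ℝ) + 1 = 3 / 8 := by norm_num
  rw [h, Real.zero_rpow (by norm_num), sub_zero]

/-- Lower bound of the Volterra term: `(128/3)·t^{3/8} ≤ ∫₀ᵗ w²(τ)(t − τ)^{−5/8} dτ` for `t > 0`.
Twin of the summit-side `…Theorems.Bazarbekov2020.volterra_lb`. [cite: Bazarbekov2020, (3,4) l.653–658 p.10] -/
private theorem volterra_lb' {t : ℝ} (ht : 0 < t) :
    128 / 3 * t ^ (3 / 8 : ℝ) ≤
      ∫ τ in Ioo 0 t, (4 + 128 / 3 * min (|τ| ^ (3 / 8 : ℝ)) 1) ^ 2 * (t - τ) ^ (-(5 / 8) : ℝ) := by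
  have hg := kernel_integrableOn' ht
  have h16 : IntegrableOn (fun τ => (16 : ℝ) * (t - τ) ^ (-(5 / 8) : ℝ)) (Ioo 0 t) := hg.const_mul 16
  have hwg : IntegrableOn
      (fun τ => (4 + 128 / 3 * min (|τ| ^ (3 / 8 : ℝ)) 1) ^ 2 * (t - τ) ^ (-(5 / 8) : ℝ)) (Ioo 0 t) := by
    refine Integrable.bdd_mul (c := (4 + 128 / 3) ^ 2) hg
      (wit_continuous'.pow 2).aestronglyMeasurable (ae_of_all _ fun τ => ?_)
    rw [Real.norm_eq_abs, abs_of_nonneg (sq_nonneg _)]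
    exact pow_le_pow_left₀ (wit_nonneg' τ) (wit_le' τ) 2
  have hmono : ∫ τ in Ioo 0 t, (16 : ℝ) * (t - τ) ^ (-(5 / 8) : ℝ) ≤
      ∫ τ in Ioo 0 t, (4 + 128 / 3 * min (|τ| ^ (3 / 8 : ℝ)) 1) ^ 2 * (t - τ) ^ (-(5 / 8) : ℝ) := by
    refine setIntegral_mono_on h16 hwg measurableSet_Ioo fun τ hτ => ?_
    have hk : 0 ≤ (t - τ) ^ (-(5 / 8) : ℝ) := Real.rpow_nonneg (by linarith [hτ.2]) _
    have hw : (16 : ℝ) ≤ (4 + 128 / 3 * min (|τ| ^ (3 / 8 : ℝ)) 1) ^ 2 := by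
      nlinarith [four_le_wit' τ]
    exact mul_le_mul_of_nonneg_right hw hk
  have hval : ∫ τ in Ioo 0 t, (16 : ℝ) * (t - τ) ^ (-(5 / 8) : ℝ) = 128 / 3 * t ^ (3 / 8 : ℝ) := by
    rw [MeasureTheory.integral_const_mul, kernel_integral' ht]
    ring
  linarith

/-- The witness satisfies (3,4) with `μ = 5/8`, `b₁ = 1`, `T = 1`, `f ≡ 8`. Twin of the summit-side
`…Theorems.Bazarbekov2020.ineq34_wit`. [cite: Bazarbekov2020, (3,4) l.653–658 p.10] -/
private theorem ineq34_wit' :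
    Ineq34 (5 / 8) 1 1 (fun t : ℝ => 4 + 128 / 3 * min (|t| ^ (3 / 8 : ℝ)) 1) (fun _ : ℝ => (8 : ℝ)) := by
  intro t ht
  show 4 + 128 / 3 * min (|t| ^ (3 / 8 : ℝ)) 1 <
    8 + 1 * ∫ τ in Ioo 0 t, (4 + 128 / 3 * min (|τ| ^ (3 / 8 : ℝ)) 1) ^ 2 * (t - τ) ^ (-(5 / 8 : ℝ))
  rw [wit_eq' ht]
  have h := volterra_lb' ht.1
  have hneg : (-(5 / 8 : ℝ)) = (-(5 / 8) : ℝ) := by norm_num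
  rw [one_mul, hneg]
  linarith

/-- `‖f‖_{L₂(0,1)} = 8`. [folklore] -/
private theorem l2_fc' : l2 1 (fun _ : ℝ => (8 : ℝ)) = 8 := by
  unfold l2
  rw [setIntegral_const, Real.volume_real_Ioo_of_le zero_le_one, sub_zero, one_smul]
  exact Real.sqrt_sq (by norm_num)

/-- `∫₀¹ (128/3)²τ² dτ = (128/3)²/3`. [folklore] -/
private theorem integral_K_sq' :
    ∫ τ in Ioo (0 : ℝ) 1, (128 / 3 : ℝ) ^ 2 * τ ^ 2 = (128 / 3 : ℝ) ^ 2 / 3 := by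
  rw [← integral_Ioc_eq_integral_Ioo, ← intervalIntegral.integral_of_le zero_le_one,
    intervalIntegral.integral_const_mul, integral_pow]
  norm_num

/-- `16 ≤ ‖w‖_{L₂(0,1)}`. Twin of the summit-side `…Theorems.Bazarbekov2020.sixteen_le_l2_wit`.
[cite: Bazarbekov2020, Thm 3.1 (3,5) l.714–719 p.11] -/
private theorem sixteen_le_l2_wit' :
    16 ≤ l2 1 (fun t : ℝ => 4 + 128 / 3 * min (|t| ^ (3 / 8 : ℝ)) 1) := by
  unfold l2
  have hK2 : IntegrableOn (fun τ : ℝ => (128 / 3 : ℝ) ^ 2 * τ ^ 2) (Ioo (0 : ℝ) 1) :=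
    ((continuous_const.mul (continuous_id.pow 2)).integrableOn_Icc (a := 0) (b := 1)).mono_set
      Ioo_subset_Icc_self
  have hmono : ∫ τ in Ioo (0 : ℝ) 1, (128 / 3 : ℝ) ^ 2 * τ ^ 2 ≤
      ∫ τ in Ioo (0 : ℝ) 1, (4 + 128 / 3 * min (|τ| ^ (3 / 8 : ℝ)) 1) ^ 2 := by
    refine setIntegral_mono_on hK2 wit_sq_integrableOn' measurableSet_Ioo fun τ hτ => ?_
    have h1 := K_mul_le_wit' ⟨hτ.1, hτ.2.le⟩
    have h0 : (0 : ℝ) ≤ 128 / 3 * τ := by nlinarith [hτ.1.le]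
    nlinarith
  rw [integral_K_sq'] at hmono
  have h256 : (256 : ℝ) ≤ (128 / 3 : ℝ) ^ 2 / 3 := by norm_num
  exact Real.le_sqrt_of_sq_le (by linarith)

/-- **Theorem 3.1 as printed is false**: the instance `μ = 5/8`, `b₁ = 1`, `T = 1`, `f ≡ 8`,
`w = 4 + (128/3)·min(|t|^{3/8},1)` satisfies (3,4) on `(0,1]` and all the typed side conditions, yet
`‖w‖_{L₂(0,1)} ≥ 16 > 8√2 = √2‖f‖_{L₂(0,1)}`.  Twin of the summit-side
`…Theorems.Bazarbekov2020.not_Step2_Theorem31` (same witness, written inline).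
[cite: Bazarbekov2020, Thm 3.1 (3,5) l.714–719 p.11; (3,4) l.653–658 p.10] -/
theorem step2_Theorem31_false : ¬ Step2_Theorem31 := by
  intro h
  have hlt := h (5 / 8) 1 1 le_rfl (by norm_num) one_pos one_pos
    (fun t : ℝ => 4 + 128 / 3 * min (|t| ^ (3 / 8 : ℝ)) 1) (fun _ : ℝ => (8 : ℝ)) wit_nonneg'
    (fun _ => by norm_num) wit_sq_integrableOn'
    (((continuous_const : Continuous fun _ : ℝ => (8 : ℝ) ^ 2).integrableOn_Icc
      (a := 0) (b := 1)).mono_set Ioo_subset_Icc_self) ineq34_wit'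
  rw [l2_fc'] at hlt
  have h16 := sixteen_le_l2_wit'
  have h4 : Real.sqrt 4 = 2 := by
    rw [show (4 : ℝ) = 2 ^ 2 by norm_num]
    exact Real.sqrt_sq (by norm_num)
  have hs : Real.sqrt 2 < 2 :=
    calc Real.sqrt 2 < Real.sqrt 4 := Real.sqrt_lt_sqrt (by norm_num) (by norm_num)
      _ = 2 := h4
  linarith

/-- **`Step3_LeraySchauder` holds — VACUOUSLY** (typed `Prop` unchanged): the inference
`Step1_Lemma32 → Step2_Theorem31 → Theorem21` is true as an implication because Theorem 3.1 as
printed is false (`step2_Theorem31_false`).  NOT the printed Leray–Schauder argument succeeding,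
and no statement about Theorem 2.1. [cite: Bazarbekov2020, Lemma 3.4 l.1098–1168, proof of Thm 2.1 l.1170–1216] -/
theorem Step3_LeraySchauder_holds : Step3_LeraySchauder := fun _ h2 => (step2_Theorem31_false h2).elim

/-- **`Step4_Section4` holds — VACUOUSLY** (typed `Prop` unchanged): `Step2_Theorem31 → Theorem41` is
true as an implication because Theorem 3.1 as printed is false (`step2_Theorem31_false`).  NOT the
printed §4 argument succeeding, and no statement about Theorem 4.1. [cite: Bazarbekov2020, §4 l.1258–1372] -/
theorem Step4_Section4_holds : Step4_Section4 := fun h2 => (step2_Theorem31_false h2).elim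

end Literature.Claims.NS.Bazarbekov2020

/-! ### Faliush 2026 — `Step_Cor1_inf` (Corollary 1 p.3), antecedent Lemma 1 first display (L1a) -/

namespace Literature.Claims.NS.Faliush2026

open UnitAddTorus
open Literature.Analysis.FunctionSpaces Literature.Analysis.FunctionSpaces.Torus
open Literature.Analysis.FluidPDE Literature.Analysis.FluidPDE.Torus

/-! The witness of the summit-side refutation — a single transversal Fourier mode `P = Re(e_k c_k)` and
its heat flow `e^{−4π²ν|k|²t} P` — with the mode `k` and the coefficient family `c` as PARAMETERS
(`-k ≠ k`, `‖c k‖ = 1`, `k · c k = 0`); no auxiliary definitions.  Twins of the summit-side lemmas of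
`…Theorems.Faliush2026`. -/

/-- Fourier support of the profile: `‖P̂(m)‖ = 1/2` on `{±k}`, `0` elsewhere. [folklore] -/
private theorem norm_coeff_mode' (k : Z3) (c : Z3 → EuclideanSpace ℂ (Fin 3)) (hne : -k ≠ k)
    (hc : ‖c k‖ = 1) (m : Z3) :
    ‖coeff (realTrigPoly {k} c) m‖ = if m = k ∨ m = -k then 1 / 2 else 0 := by
  show ‖mFourierCoeff (EuclideanSpace.complexify ∘ realTrigPoly {k} c) m‖ = _
  rw [mFourierCoeff_realTrigPoly_singleton]
  by_cases h1 : m = k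
  · have h2 : m ≠ -k := fun h => hne (h.symm.trans h1)
    rw [if_pos h1, if_neg h2, if_pos (Or.inl h1), EuclideanSpace.conjVec_zero, add_zero, norm_smul,
      norm_inv, Complex.norm_ofNat, hc]
    norm_num
  · by_cases h2 : m = -k
    · rw [if_neg h1, if_pos h2, if_pos (Or.inr h2), zero_add, norm_smul, norm_inv, Complex.norm_ofNat,
        EuclideanSpace.norm_conjVec, hc]
      norm_num
    · rw [if_neg h1, if_neg h2, if_neg (not_or.2 ⟨h1, h2⟩), EuclideanSpace.conjVec_zero, add_zero,
        smul_zero, norm_zero]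

/-- Weighted Plancherel sums of the profile: `Σ_m φ(m)‖P̂(m)‖² = φ(k)/2` for even-at-`k` weights.
[folklore] -/
private theorem tsum_weight' (k : Z3) (c : Z3 → EuclideanSpace ℂ (Fin 3)) (hne : -k ≠ k)
    (hc : ‖c k‖ = 1) (φ : Z3 → ℝ) (hφ : φ (-k) = φ k) :
    ∑' m : Z3, φ m * ‖coeff (realTrigPoly {k} c) m‖ ^ 2 = φ k / 2 := by
  simp_rw [norm_coeff_mode' k c hne hc]
  rw [tsum_eq_sum (s := ({k, -k} : Finset Z3)) fun m hm => by
    rw [Finset.mem_insert, Finset.mem_singleton, not_or] at hm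
    rw [if_neg (not_or.2 ⟨hm.1, hm.2⟩)]; ring]
  rw [Finset.sum_pair hne.symm, if_pos (Or.inl rfl), if_pos (Or.inr rfl), hφ]
  ring

/-- `G_σ` along the heat flow of the mode: `G_σ(e^{as} P) = (e^{as})²·e^{−8π²σ|k|²}/2`. [folklore] -/
private theorem Gw_mode' (k : Z3) (c : Z3 → EuclideanSpace ℂ (Fin 3)) (hne : -k ≠ k)
    (hc : ‖c k‖ = 1) (ν σ s : ℝ) :
    Gw σ (fun x => Real.exp (-(ν * (4 * Real.pi ^ 2 * freqNormSq k)) * s) • realTrigPoly {k} c x) =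
      Real.exp (-(ν * (4 * Real.pi ^ 2 * freqNormSq k)) * s) ^ 2 * (Torus.heatCoeff (2 * σ) k / 2) := by
  have hcf : ∀ m : Z3,
      ‖coeff (fun x => Real.exp (-(ν * (4 * Real.pi ^ 2 * freqNormSq k)) * s) • realTrigPoly {k} c x) m‖ =
        |Real.exp (-(ν * (4 * Real.pi ^ 2 * freqNormSq k)) * s)| * ‖coeff (realTrigPoly {k} c) m‖ :=
    fun m => norm_mFourierCoeff_complexify_const_smul _ _ _
  unfold Gw
  simp_rw [hcf, mul_pow, sq_abs, mul_left_comm (Torus.heatCoeff _ _)]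
  rw [tsum_mul_left, tsum_weight' k c hne hc (fun m => Torus.heatCoeff (2 * σ) m) (by
    simp only [Torus.heatCoeff_apply, freqNormSq_neg])]

/-- `D̃_σ(P) = (4π²|k|²)²·e^{−4π²σ|k|²}/2`. [folklore] -/
private theorem Dw_mode' (k : Z3) (c : Z3 → EuclideanSpace ℂ (Fin 3)) (hne : -k ≠ k)
    (hc : ‖c k‖ = 1) (σ : ℝ) :
    Dw σ (realTrigPoly {k} c) = lapSymb k ^ 2 * Torus.heatCoeff σ k / 2 := by
  unfold Dw
  exact tsum_weight' k c hne hc (fun m => lapSymb m ^ 2 * Torus.heatCoeff σ m) (by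
    simp only [lapSymb, Torus.heatCoeff_apply, freqNormSq_neg])

/-- The transfer pairing vanishes on a transversal single mode: `(P·∇)P = 0`. [folklore] -/
private theorem pairW_convect_mode' (k : Z3) (c : Z3 → EuclideanSpace ℂ (Fin 3))
    (hz : ∑ j, (k j : ℂ) * c k j = 0) (σ : ℝ) :
    pairW σ (Torus.convect (realTrigPoly {k} c) (realTrigPoly {k} c)) (realTrigPoly {k} c) = 0 := by
  have hconv : Torus.convect (realTrigPoly {k} c) (realTrigPoly {k} c) =
      fun x => (0 : ℝ) • realTrigPoly {k} c x := by
    funext x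
    rw [zero_smul]
    exact Torus.convect_realTrigPoly_singleton_self_eq_zero hz x
  have h0 : ∀ m : Z3, coeff (Torus.convect (realTrigPoly {k} c) (realTrigPoly {k} c)) m = 0 := by
    intro m
    rw [← norm_eq_zero, hconv]
    rw [show ‖coeff (fun x => (0 : ℝ) • realTrigPoly {k} c x) m‖ = |(0 : ℝ)| * ‖coeff (realTrigPoly {k} c) m‖
      from norm_mFourierCoeff_complexify_const_smul _ _ _, abs_zero, zero_mul]
  unfold pairW
  simp_rw [h0, inner_zero_left, map_zero, mul_zero, tsum_zero]

/-- The refutation of L1a from ANY transversal unit single mode of frequency `|k|² = 1`: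
at `ν = σ = T = 1`, `t = 0` the true derivative of `G_1` along the heat flow is `2a·g`
(`a = −4π²`, `g = e^{−8π²}/2`) while the printed right side is `−(4π²)² e^{−4π²}`; equality would
force `4π² x (x − 4π²) = 0` with `0 < x = e^{−4π²} < 1`. [cite: Faliush2026, Lemma 1 p.2 l.37–40] -/
private theorem step_L1a_false_of_mode (k : Z3) (c : Z3 → EuclideanSpace ℂ (Fin 3))
    (hk : freqNormSq k = 1) (hne : -k ≠ k) (hz : ∑ j, (k j : ℂ) * c k j = 0) (hc : ‖c k‖ = 1) :
    ¬ Step_L1a := by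
  intro h
  have hsol := (Torus.isClassicalNSSolutionOn_expDecay_realTrigPoly_singleton 1 (k₀ := k) (c := c)
    hz).mono Icc_subset_Ici_self (uniqueDiffOn_Icc one_pos)
  set a : ℝ := -((1 : ℝ) * (4 * Real.pi ^ 2 * freqNormSq k)) with ha
  set g : ℝ := Torus.heatCoeff (2 * 1) k / 2 with hg
  have hclaim := h 1 one_pos 1 one_pos _ _ hsol 1 one_pos 0 ⟨le_rfl, zero_le_one⟩
  have hfun : (fun s : ℝ => Gw 1 (fun x => Real.exp (-((1 : ℝ) * (4 * Real.pi ^ 2 * freqNormSq k)) * s) •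
      realTrigPoly {k} c x)) = fun s => Real.exp (a * s) ^ 2 * g := by
    funext s
    rw [Gw_mode' k c hne hc]
  have hzero : (fun x => Real.exp (-((1 : ℝ) * (4 * Real.pi ^ 2 * freqNormSq k)) * 0) •
      realTrigPoly {k} c x) = realTrigPoly {k} c := by
    funext x
    simp
  rw [hfun, hzero, Dw_mode' k c hne hc, pairW_convect_mode' k c hz] at hclaim
  -- the true derivative at `s = 0`
  have h1 : HasDerivAt (fun s : ℝ => a * s) a 0 := by
    simpa using (hasDerivAt_id (0 : ℝ)).const_mul a
  have h4 : HasDerivAt (fun s : ℝ => Real.exp (a * s) ^ 2 * g) (2 * a * g) 0 := by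
    have h3 := ((h1.exp).pow 2).mul_const g
    refine h3.congr_deriv ?_
    simp [Real.exp_zero]
  have huniq : UniqueDiffWithinAt ℝ (Icc (0 : ℝ) 1) 0 :=
    uniqueDiffOn_Icc one_pos 0 (left_mem_Icc.2 zero_le_one)
  have heq := huniq.eq_deriv _ h4.hasDerivWithinAt hclaim
  -- evaluate the symbols at `|k|² = 1`
  rw [hg, ha, Torus.heatCoeff_apply, Torus.heatCoeff_apply, lapSymb, hk] at heq
  set x : ℝ := Real.exp (-(4 * Real.pi ^ 2 * 1 * 1)) with hx
  have hx2 : Real.exp (-(4 * Real.pi ^ 2 * 1 * (2 * 1))) = x ^ 2 := by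
    rw [hx, ← Real.exp_nat_mul]
    congr 1
    push_cast
    ring
  rw [hx2] at heq
  have hxpos : 0 < x := Real.exp_pos _
  have hx1 : x < 1 := Real.exp_lt_one_iff.2 (by nlinarith [Real.pi_gt_three])
  have hpi := Real.pi_gt_three
  have key : (4 * Real.pi ^ 2) * x * (x - 4 * Real.pi ^ 2) = 0 := by
    linear_combination (-1 : ℝ) * heq
  rcases mul_eq_zero.1 key with h' | h'
  · have : (0 : ℝ) < 4 * Real.pi ^ 2 * x := by positivity
    exact this.ne' h'
  · nlinarith

/-- **Lemma 1, first display (L1a) is false as typed** («d/dt G_σ(u) = −2ν D̃_σ(u) + 2⟨e^{σΔ}(u·∇u),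
e^{σΔ}u⟩ for smooth solutions»): witness `ν = σ = T = 1`, `t = 0`, the shear heat flow of the mode
`k₀ = (1,0,0)` with coefficient `(0,1,0)` (`step_L1a_false_of_mode`).  Twin of the summit-side
`…Theorems.Faliush2026.not_Step_L1a` (same witness). [cite: Faliush2026, Lemma 1 p.2 l.37–40] -/
theorem step_L1a_false : ¬ Step_L1a := by
  refine step_L1a_false_of_mode (Pi.single (0 : Fin 3) (1 : ℤ))
    (fun _ => EuclideanSpace.single (1 : Fin 3) (1 : ℂ)) ?_ ?_ ?_ ?_
  · simp [freqNormSq, Pi.single_apply]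
  · intro h'
    have h0 := congrFun h' 0
    simp at h0
  · simp [Pi.single_apply]
  · simp

/-- `‖P‖²_{L²} = 1/2` for a unit single mode (Parseval). [folklore] -/
private theorem l2Sq_mode' (k : Z3) (c : Z3 → EuclideanSpace ℂ (Fin 3)) (hne : -k ≠ k)
    (hc : ‖c k‖ = 1) : l2Sq (realTrigPoly {k} c) = 1 / 2 := by
  unfold l2Sq
  rw [integral_norm_sq_eq_tsum (memLp_realTrigPoly {k} c 2)]
  have h := tsum_weight' k c hne hc (fun _ => (1 : ℝ)) rfl
  simp only [one_mul] at h
  exact h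

/-- `‖ΔP‖²_{L²} = (4π²|k|²)²/2` for a unit single mode. [folklore] -/
private theorem lapSq_mode' (k : Z3) (c : Z3 → EuclideanSpace ℂ (Fin 3)) (hne : -k ≠ k)
    (hc : ‖c k‖ = 1) : lapSq (realTrigPoly {k} c) = lapSymb k ^ 2 * (1 / 2) := by
  unfold lapSq
  rw [← l2Sq_mode' k c hne hc]
  unfold l2Sq
  rw [← MeasureTheory.integral_const_mul]
  congr 1 with x
  rw [laplacian_realTrigPoly_singleton, norm_smul, mul_pow, Real.norm_eq_abs, sq_abs, lapSymb, neg_sq]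

/-- The refutation of (4) from transversal unit modes `K n` of frequency `|K n|² = n²`: at
`ν = σ = 1`, `t = 0`, the mode with `n > max(C, 1)` gives `(4π²n²)² ≤ C((4π²n²)² e^{−4π²n²} + 1)`,
impossible. [cite: Faliush2026, Lemma 1 (4) p.2 l.41–50] -/
private theorem step_L1b_false_of_modes
    (K : ℕ → Z3) (c : Z3 → EuclideanSpace ℂ (Fin 3)) (hK : ∀ n : ℕ, freqNormSq (K n) = (n : ℝ) ^ 2)
    (hne : ∀ n : ℕ, n ≠ 0 → -K n ≠ K n) (hz : ∀ n : ℕ, ∑ j, (K n j : ℂ) * c (K n) j = 0)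
    (hc : ∀ n : ℕ, ‖c (K n)‖ = 1) : ¬ Step_L1b := by
  intro h
  obtain ⟨C, hC⟩ := h 1 one_pos 1 one_pos
  -- the frequency `n = ⌈C⌉₊ + 1`
  set n : ℕ := ⌈C⌉₊ + 1 with hn
  have hn0 : n ≠ 0 := Nat.succ_ne_zero _
  have hnC : C < (n : ℝ) := by
    have := Nat.le_ceil C
    rw [hn]; push_cast
    linarith
  have hn1 : (1 : ℝ) ≤ n := by rw [hn]; push_cast; linarith [Nat.cast_nonneg (α := ℝ) ⌈C⌉₊]
  have hsol := (Torus.isClassicalNSSolutionOn_expDecay_realTrigPoly_singleton 1 (k₀ := K n) (c := c)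
    (hz n)).mono Icc_subset_Ici_self (uniqueDiffOn_Icc one_pos)
  have hclaim := hC 1 one_pos _ _ hsol 0 ⟨le_rfl, zero_le_one⟩
  have hzero : (fun x => Real.exp (-((1 : ℝ) * (4 * Real.pi ^ 2 * freqNormSq (K n))) * 0) •
      realTrigPoly {K n} c x) = realTrigPoly {K n} c := by
    funext x
    simp
  rw [hzero, lapSq_mode' (K n) c (hne n hn0) (hc n), Dw_mode' (K n) c (hne n hn0) (hc n),
    l2Sq_mode' (K n) c (hne n hn0) (hc n), lapSymb, hK, Torus.heatCoeff_apply, hK, mul_one] at hclaim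
  -- abbreviations
  set L : ℝ := 4 * Real.pi ^ 2 * (n : ℝ) ^ 2 with hL
  set x : ℝ := Real.exp (-(4 * Real.pi ^ 2 * (n : ℝ) ^ 2)) with hx
  have hpi := Real.pi_gt_three
  have hLpos : 0 < L := by positivity
  have hxpos : 0 < x := Real.exp_pos _
  -- `x · (1 + L) ≤ 1`
  have hxL : x * (1 + L) ≤ 1 := by
    have h1 : 1 + L ≤ Real.exp L := by
      have := Real.add_one_le_exp L
      linarith
    have h2 : x * Real.exp L = 1 := by
      rw [hx, hL, ← Real.exp_add]
      simp
    calc x * (1 + L) ≤ x * Real.exp L := by gcongr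
      _ = 1 := h2
  -- the displayed inequality: `L²/2 ≤ C (L² x / 2 + 1/2)`
  have key : L ^ 2 * (1 / 2) ≤ C * (L ^ 2 * x / 2 + 1 / 2) := hclaim
  have hpi2 : 9 < Real.pi ^ 2 := by nlinarith
  have hn2 : (n : ℝ) ≤ (n : ℝ) ^ 2 := by nlinarith
  have hL36 : 36 ≤ L := by rw [hL]; nlinarith
  by_cases hC0 : C ≤ 0
  · have : C * (L ^ 2 * x / 2 + 1 / 2) ≤ 0 :=
      mul_nonpos_of_nonpos_of_nonneg hC0 (by positivity)
    nlinarith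
  · push Not at hC0
    have h1 : C * x * L ≤ C := by nlinarith
    have h2 : 36 * C ≤ L := by
      rw [hL]
      have : 36 * C ≤ 36 * (n : ℝ) := by linarith
      nlinarith
    have hCx2 : C * x ≤ 1 / 2 := by
      by_contra hnot
      push Not at hnot
      nlinarith
    have h3 : C * (L ^ 2 * x) ≤ L ^ 2 * (1 / 2) := by
      have := mul_le_mul_of_nonneg_left hCx2 (sq_nonneg L)
      linarith [this]
    have h4 : L ^ 2 ≤ 2 * C := by nlinarith
    have h5 : 36 * (36 * C) ≤ L ^ 2 := by nlinarith
    nlinarith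

/-- **Lemma 1 (4) (L1b) is false as typed** («‖Δu‖²_{L²} ≤ C(D̃_σ(u) + ‖u‖²_{L²})» with one `C` per
`(ν, σ)`): one high shear mode `k_n = (n,0,0)`, coefficient `(0,1,0)`, `n > max(C,1)`
(`step_L1b_false_of_modes`).  Twin of the summit-side `…Theorems.Faliush2026.not_Step_L1b` (same
witness family). [cite: Faliush2026, Lemma 1 (4) p.2 l.41–50] -/
theorem step_L1b_false : ¬ Step_L1b := by
  refine step_L1b_false_of_modes (fun n : ℕ => Pi.single (0 : Fin 3) (n : ℤ))
    (fun _ => EuclideanSpace.single (1 : Fin 3) (1 : ℂ)) ?_ ?_ ?_ ?_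
  · intro n
    simp [freqNormSq, Pi.single_apply]
  · intro n hn h'
    have h0 := congrFun h' 0
    simp only [Pi.neg_apply, Pi.single_eq_same] at h0
    omega
  · intro n
    simp [Pi.single_apply]
  · intro n
    simp

/-- **`Step_closure` holds — VACUOUSLY** (typed `Prop` unchanged): `Step_P1 → Step_L1b → Step_Thm1` is
true as an implication because Lemma 1 (4) is false as typed (`step_L1b_false`).  NOT the printed
§4.4 closure succeeding: Theorem 1 is refuted summit-side. [cite: Faliush2026, §4.4 p.3 l.44–45] -/
theorem Step_closure_holds : Step_closure := fun _ h => (step_L1b_false h).elim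

/-- **`Step_Cor1_inf` holds — VACUOUSLY** (typed `Prop` unchanged): `Step_L1a → Step_Thm1 → Step_Cor1`
is true as an implication because Lemma 1's first display is false as typed (`step_L1a_false`; the
second antecedent, Theorem 1, is refuted summit-side as well).  NOT the printed Corollary 1 inference
succeeding. [cite: Faliush2026, Corollary 1 p.3 l.47] -/
theorem Step_Cor1_inf_holds : Step_Cor1_inf := fun h _ => (step_L1a_false h).elim

end Literature.Claims.NS.Faliush2026

/-! ### Wayman 2026 — `Step_Prop14` (Prop 14 p.31), antecedent Theorem 13 as printed -/

namespace Literature.Claims.NS.Wayman2026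

open Real Literature.Analysis.FluidPDE

/-! The witness of the summit-side refutation: the single-mode shear/Beltrami wave
`v_κ(x) = (sin κx₃, cos κx₃, 0) = abc 1 0 0 (κ • x)` and its exact viscous evolution
`e^{−νκ²t} v_κ` (`strongBeltramiVelocity`), with the wavenumber `κ` as a PARAMETER (`κ = √3/π = 1/a*`
at the end); no auxiliary definitions.  Twins of the lemmas of `…Theorems.Wayman2026`. -/

/-- Pure dilation under the curl: `curl (U(c ·))(y) = c • (curl U)(c y)`. [folklore] -/
private theorem curl_comp_smul' (U : E3 → E3) (c : ℝ) (y : E3) :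
    curl (fun z => U (c • z)) y = c • curl U (c • y) := by
  rw [curl_eq_curlCLM, curl_eq_curlCLM, _root_.fderiv_comp_smul, map_smul]

/-- `|v_κ(x)| = 1` everywhere. [folklore] -/
private theorem norm_wave' (κ : ℝ) (x : E3) : ‖ABC.abc 1 0 0 (κ • x)‖ = 1 := by
  rw [EuclideanSpace.norm_eq, Fin.sum_univ_three]
  simp [sin_sq_add_cos_sq]

/-- `v_κ` is smooth. [folklore] -/
private theorem contDiff_wave' (κ : ℝ) {n : WithTop ℕ∞} :
    ContDiff ℝ n (fun z : E3 => ABC.abc 1 0 0 (κ • z)) :=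
  (ABC.contDiff_abc 1 0 0).comp (contDiff_const_smul κ)

/-- `div v_κ = 0`. [folklore] -/
private theorem isDivFree_wave' (κ : ℝ) :
    VectorCalculus.IsDivFree (fun z : E3 => ABC.abc 1 0 0 (κ • z)) :=
  (ABC.isDivFree_abc 1 0 0).comp_smul κ

/-- `curl v_κ = κ v_κ` (strong Beltrami with eigenvalue `κ`). [cite: MajdaBertozziCUP2002, §2.3.2 Prop. 2.10] -/
private theorem curl_wave' (κ : ℝ) (x : E3) :
    curl (fun z : E3 => ABC.abc 1 0 0 (κ • z)) x = κ • ABC.abc 1 0 0 (κ • x) := by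
  rw [curl_comp_smul', ABC.curl_abc]

/-- `v_κ` is a strong Beltrami field. [cite: MajdaBertozziCUP2002, §2.3.2 Prop. 2.10] -/
private theorem isBeltrami_wave' (κ : ℝ) :
    IsBeltrami (fun z : E3 => ABC.abc 1 0 0 (κ • z)) fun _ => κ := fun x => curl_wave' κ x

/-- `v_κ` is `2π/κ`-periodic in every coordinate direction (`κ ≠ 0`). [folklore] -/
private theorem wave_periodic' (κ : ℝ) (hκ : κ ≠ 0) (x : E3) (j : Fin 3) :
    ABC.abc 1 0 0 (κ • (x + (2 * π / κ) • EuclideanSpace.single j 1)) = ABC.abc 1 0 0 (κ • x) := by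
  have hc : κ • (x + (2 * π / κ) • EuclideanSpace.single j (1:ℝ)) =
      κ • x + (2 * π) • EuclideanSpace.single j 1 := by
    rw [smul_add, smul_smul, mul_div_cancel₀ _ hκ]
  rw [hc]
  ext i
  fin_cases j <;> fin_cases i <;> simp [ABC.abc, sin_add_two_pi, cos_add_two_pi]

/-- The viscous wave `e^{−κ²νt} v_κ` with Bernoulli pressure is a classical Navier–Stokes solution on
`ℝ × E3` (no force). [cite: MajdaBertozziCUP2002, §2.3.2 p. 61] -/
private theorem ns_wave' (ν κ : ℝ) :
    IsClassicalNSSolutionOn univ ν 0 (strongBeltramiVelocity ν κ (fun z : E3 => ABC.abc 1 0 0 (κ • z)))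
      (strongBeltramiPressure ν κ (fun z : E3 => ABC.abc 1 0 0 (κ • z))) :=
  isClassicalNSSolutionOn_strongBeltrami ν (isBeltrami_wave' κ) (contDiff_wave' κ) (isDivFree_wave' κ)

/-- `curl u(t) = κ e^{−κ²νt} v_κ`. [folklore] -/
private theorem curl_sol' (ν κ t : ℝ) (x : E3) :
    curl (strongBeltramiVelocity ν κ (fun z : E3 => ABC.abc 1 0 0 (κ • z)) t) x =
      (exp (-(κ ^ 2 * ν) * t) * κ) • ABC.abc 1 0 0 (κ • x) := by
  have h : strongBeltramiVelocity ν κ (fun z : E3 => ABC.abc 1 0 0 (κ • z)) t =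
      fun y => exp (-(κ ^ 2 * ν) * t) • (fun z : E3 => ABC.abc 1 0 0 (κ • z)) y := rfl
  rw [h, curl_const_smul (((contDiff_wave' κ (n := 1)).differentiable one_ne_zero x)), curl_wave',
    smul_smul]

/-- `|ω(t,x)| = κ e^{−κ²νt}` everywhere (`κ ≥ 0`). [folklore] -/
private theorem norm_curl_sol' (ν κ t : ℝ) (hκ : 0 ≤ κ) (x : E3) :
    ‖curl (strongBeltramiVelocity ν κ (fun z : E3 => ABC.abc 1 0 0 (κ • z)) t) x‖ =
      κ * exp (-(κ ^ 2 * ν) * t) := by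
  rw [curl_sol', norm_smul, norm_wave', mul_one, Real.norm_of_nonneg (by positivity), mul_comm]

/-- `‖ω(t)‖_{L∞} = κ e^{−κ²νt}` in the skeleton's `supN`. [folklore] -/
private theorem supN_curl_sol' (ν κ t : ℝ) (hκ : 0 ≤ κ) :
    supN (curl (strongBeltramiVelocity ν κ (fun z : E3 => ABC.abc 1 0 0 (κ • z)) t)) =
      κ * exp (-(κ ^ 2 * ν) * t) := by
  unfold supN
  simp_rw [norm_curl_sol' ν κ t hκ]
  exact ciSup_const

/-- `‖ω₀‖_{L∞} = κ` for the datum `v_κ`. [folklore] -/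
private theorem supN_curl_wave' (κ : ℝ) (hκ : 0 ≤ κ) :
    supN (curl (fun z : E3 => ABC.abc 1 0 0 (κ • z))) = κ := by
  unfold supN
  simp_rw [curl_wave', norm_smul, norm_wave', mul_one, Real.norm_of_nonneg hκ]
  exact ciSup_const

/-- `v_κ` is `per`-periodic when `2π/κ = per`. [cite: Wayman2026, Def 5 p.7 l.23–26] -/
private theorem isPer_wave' (κ : ℝ) (hκ : 0 < κ) (hper : 2 * π / κ = per) :
    IsPer per (fun z : E3 => ABC.abc 1 0 0 (κ • z)) := by
  intro j x
  show ABC.abc 1 0 0 (κ • (x + per • EuclideanSpace.single j 1)) = ABC.abc 1 0 0 (κ • x)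
  rw [← hper]
  exact wave_periodic' κ hκ.ne' x j

/-- `v_κ` is an admissible datum on `T³(a*)` when `2π/κ = per`. [cite: Wayman2026, Def 5 p.7 l.21–26] -/
private theorem isDatum_wave' (κ : ℝ) (hκ : 0 < κ) (hper : 2 * π / κ = per) :
    IsDatum per (fun z : E3 => ABC.abc 1 0 0 (κ • z)) :=
  ⟨contDiff_wave' κ, fun x => isDivFree_wave' κ x, isPer_wave' κ hκ hper⟩

/-- The velocity slices are `per`-periodic. [folklore] -/
private theorem isPer_solU' (ν t κ : ℝ) (hκ : 0 < κ) (hper : 2 * π / κ = per) :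
    IsPer per (strongBeltramiVelocity ν κ (fun z : E3 => ABC.abc 1 0 0 (κ • z)) t) := by
  intro j x
  simp only [strongBeltramiVelocity_apply]
  exact congrArg (fun v : E3 => exp (-(κ ^ 2 * ν) * t) • v) (isPer_wave' κ hκ hper j x)

/-- The pressure slices are constant in space, hence `per`-periodic. [folklore] -/
private theorem isPer_solP' (ν t κ : ℝ) :
    IsPer per (strongBeltramiPressure ν κ (fun z : E3 => ABC.abc 1 0 0 (κ • z)) t) := by
  intro j x
  simp only [strongBeltramiPressure, norm_wave']

/-- The wave is a global Clay-sense solution on `T³(a*)` (skeleton `IsGlobalSol`), via the tree's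
bridge `isNavierStokesSolution_and_smooth_iff`. [cite: Wayman2026, Thm 13 (1) p.30 l.55 – p.31 l.5] -/
private theorem isGlobalSol_wave' (ν κ : ℝ) (hκ : 0 < κ) (hper : 2 * π / κ = per) :
    IsGlobalSol per ν (fun z : E3 => ABC.abc 1 0 0 (κ • z))
      (strongBeltramiVelocity ν κ (fun z : E3 => ABC.abc 1 0 0 (κ • z)))
      (strongBeltramiPressure ν κ (fun z : E3 => ABC.abc 1 0 0 (κ • z))) := by
  have hcl : IsClassicalNSSolutionOn (Ici 0) ν 0
      (strongBeltramiVelocity ν κ (fun z : E3 => ABC.abc 1 0 0 (κ • z)))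
      (strongBeltramiPressure ν κ (fun z : E3 => ABC.abc 1 0 0 (κ • z))) :=
    (ns_wave' ν κ).mono (subset_univ _) (uniqueDiffOn_Ici 0)
  obtain ⟨hns, hu, hp⟩ :=
    (isNavierStokesSolution_and_smooth_iff).2
      ⟨hcl, strongBeltramiVelocity_zero ν κ (fun z : E3 => ABC.abc 1 0 0 (κ • z))⟩
  exact ⟨hu, hp, hns, fun t _ => isPer_solU' ν t κ hκ hper, fun t _ => isPer_solP' ν t κ⟩

/-- Thm 13 (2) fails along the wave of ANY wavenumber `κ > 0` with the printed period (`2π/κ = per`)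
whose one-period contraction at `ν = 1/4` beats the printed loop gain (`γ < e^{−κ²τ/4}`): `k = 1` gives
`κ e^{−κ²τ/4} ≤ κ γ`. [cite: Wayman2026, Thm 13 (2) p.31 l.6–14] -/
private theorem thm13_2_false_of (κ : ℝ) (hκ : 0 < κ) (hper : 2 * π / κ = per)
    (hdec : gam < exp (-(κ ^ 2 * (1 / 4)) * ((1 : ℝ) * tau))) : ¬ Thm13_2 per tau := by
  intro h
  have h1 := h (1 / 4) (by norm_num) _ (isDatum_wave' κ hκ hper) _ _ (isGlobalSol_wave' (1 / 4) κ hκ hper) 1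
  rw [Nat.cast_one, pow_one, supN_curl_sol' _ _ _ hκ.le, supN_curl_wave' _ hκ.le] at h1
  nlinarith [hκ, h1, hdec]

/-- `√3 > 1.73`. [folklore] -/
private theorem sqrt3_gt' : (173 : ℝ) / 100 < sqrt 3 := by
  rw [show (173:ℝ)/100 = sqrt ((173/100)^2) by rw [sqrt_sq]; norm_num]
  exact sqrt_lt_sqrt (by norm_num) (by norm_num)

/-- `√3 < 1.733`. [folklore] -/
private theorem sqrt3_lt' : sqrt 3 < (1733 : ℝ) / 1000 := by
  rw [show (1733:ℝ)/1000 = sqrt ((1733/1000)^2) by rw [sqrt_sq]; norm_num]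
  exact sqrt_lt_sqrt (by norm_num) (by norm_num)

/-- `γ = (π²−3)/(2√3π) < 16/25`. [cite: Wayman2026, Thm 8 (50) p.18] -/
private theorem gam_lt' : gam < 16 / 25 := by
  have hπ1 := pi_gt_d2
  have hπ2 := pi_lt_d2
  have h3 := sqrt3_gt'
  unfold gam
  rw [div_lt_iff₀ (by positivity)]
  nlinarith

/-- `κ²τ = 2√3/π` for `κ = √3/π`. [cite: Wayman2026, Thm 13 (2) p.31 l.10–14] -/
private theorem kap_sq_mul_tau' : (sqrt 3 / π) ^ 2 * tau = 2 * sqrt 3 / π := by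
  unfold tau
  have hπ : π ≠ 0 := pi_ne_zero
  have h3 : sqrt 3 ≠ 0 := by positivity
  have hs : sqrt 3 ^ 2 = 3 := sq_sqrt (by norm_num)
  field_simp

/-- `2√3/π < 1.11`. [folklore] -/
private theorem two_sqrt3_div_pi_lt' : 2 * sqrt 3 / π < 111 / 100 := by
  have hπ1 := pi_gt_d2
  have h3 := sqrt3_lt'
  rw [div_lt_iff₀ pi_pos]
  nlinarith

/-- **The decisive comparison** at `ν = 1/4`, `κ = √3/π`: `γ < e^{−κ²τ/4}` (`κ²τ/4 = √3/(2π) ≤ 0.2775`,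
`γ < 16/25 < 1 − 0.2775`). [cite: Wayman2026, Thm 9 (53) p.21] -/
private theorem gam_lt_decay' : gam < exp (-((sqrt 3 / π) ^ 2 * (1 / 4)) * ((1 : ℝ) * tau)) := by
  have hk : (sqrt 3 / π) ^ 2 * (1 / 4) * ((1 : ℝ) * tau) = (2 * sqrt 3 / π) * (1 / 4) := by
    rw [one_mul, mul_comm ((sqrt 3 / π) ^ 2) (1 / 4), mul_assoc, kap_sq_mul_tau']; ring
  rw [neg_mul, hk]
  have h := two_sqrt3_div_pi_lt'
  have h0 : 0 ≤ 2 * sqrt 3 / π := by positivity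
  have h1 := gam_lt'
  have h2 : -(2 * sqrt 3 / π * (1 / 4)) + 1 ≤ exp (-(2 * sqrt 3 / π * (1 / 4))) := add_one_le_exp _
  nlinarith

/-- `2π/κ = per` for `κ = √3/π = 1/a*`: the wave has exactly the printed period. [cite: Wayman2026, Def 5 p.7 l.23–26] -/
private theorem two_pi_div_kap' : 2 * π / (sqrt 3 / π) = per := by
  unfold per aStar
  have hπ : π ≠ 0 := pi_ne_zero
  have h3 : sqrt 3 ≠ 0 := by positivity
  field_simp

/-- **Thm 13 (2) as printed is false** («the peak vorticity decays geometrically: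
‖ω(kτ)‖_{L∞} ≤ ‖ω₀‖_{L∞} γ^k»): along the GLOBAL Clay-sense wave `e^{−νκ²t}(sin κx₃, cos κx₃, 0)`,
`κ = √3/π`, at `ν = 1/4`, `k = 1`: `κe^{−√3/(2π)} > κγ`.  Twin of the summit-side
`…Theorems.Wayman2026.not_Thm13_2` (same witness, wavenumber as a parameter of the private lemmas).
[cite: Wayman2026, Thm 13 (2) p.31 l.6–14] -/
theorem thm13_2_false : ¬ Thm13_2 per tau :=
  thm13_2_false_of (sqrt 3 / π) (by positivity) two_pi_div_kap' gam_lt_decay'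

/-- **Theorem 13 p.30–31 AS PRINTED is false**, through part (2). Twin of the summit-side
`…Theorems.Wayman2026.not_Thm13_asPrinted`. [cite: Wayman2026, Thm 13 p.30 l.49 – p.31 l.17] -/
theorem thm13_asPrinted_false : ¬ ClaimedTheorem := fun h => thm13_2_false h.2.1

/-- **`Step_Prop14` holds — VACUOUSLY** (typed `Prop` unchanged): `ClaimedTheorem → ClaimedCubic` is true
as an implication because Theorem 13 as printed is false (`thm13_asPrinted_false`).  NOT the printed
rescaling (79) succeeding, and no statement about Theorem 13 (1) (global regularity) on any torus.
[cite: Wayman2026, Prop 14 (79) p.31 l.26–90] -/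
theorem Step_Prop14_holds : Step_Prop14 := fun h => (thm13_asPrinted_false h).elim

end Literature.Claims.NS.Wayman2026

/-! ### Otelbaev 2013 — `Theorem2_of_Theorem62` (§7 p.73 / Lemma 7.15 p.84), antecedent Theorem 6.2 -/

namespace Literature.Claims.NS.Otelbaev2013

/-- **`Theorem2_of_Theorem62` holds — VACUOUSLY** (typed `Prop` unchanged): `Theorem62 → Theorem2I` is
true as an implication because Theorem 6.2 as printed is false — refuted LITERATURE-side already by the
barrier file `Literature.Barriers.NavierStokesRegularity.not_otelbaev2013_theorem62` (the finite
direct-sum block with `L_P ≡ 0`; summit-side twin `…Theorems.Otelbaev2013.not_Theorem62`).  NOT the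
printed §7 inference succeeding, and no statement about Theorem 2. The summit-side cell records the
parallel vacuous step `Theorem62_of_Theorem61` the same way (`theorem62_of_theorem61_vacuous`).
[cite: Otelbaev2013, §7 p.73 and Lemma 7.15 p.84] -/
theorem Theorem2_of_Theorem62_holds : Theorem2_of_Theorem62 := fun h =>
  (Literature.Barriers.NavierStokesRegularity.not_otelbaev2013_theorem62 h).elim

end Literature.Claims.NS.Otelbaev2013


/-! ### Nguyen 2022 — `Step6_Section4` (§4 pp.20–23), antecedent Theorem 3.0.1 as printed -/

namespace Literature.Claims.NS.Nguyen2022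

open MeasureTheory Metric Literature.Analysis.FluidPDE

/-! The witness of the summit-side refutation `…Theorems.Nguyen2022.not_Step5_Theorem301` — the field
`u(t,x) = a(t)·w(c(t)x)` on `ℝ³ × [0, 1/2)` with `c² = e(1+2t)/(‖∇w‖₂²(1−t−t²))`, `a² = (1−t−t²)c³`
(energy `e(1−t−t²)`, enstrophy `e(1+2t)`) — rebuilt with the spatial profile `w` and the two numbers
`e = ‖w‖₂²`, `z = ‖∇w‖₂²` as PARAMETERS of private lemmas (no auxiliary definitions); the concrete
bump profile enters only in the last step. -/

/-- Change of variables `x ↦ R·x` in `ℝ³` for the lower Lebesgue integral. [folklore] -/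
private theorem lintegral_comp_smul' (f : EuclideanSpace ℝ (Fin 3) → ℝ≥0∞) {R : ℝ} (hR : R ≠ 0) :
    ∫⁻ x, f (R • x) = ENNReal.ofReal |(R ^ 3)⁻¹| * ∫⁻ x, f x := by
  calc ∫⁻ x, f (R • x) = ∫⁻ y, f y ∂(Measure.map (fun x : EuclideanSpace ℝ (Fin 3) => R • x) volume) :=
        (lintegral_map_equiv f
          (Homeomorph.smul (isUnit_iff_ne_zero.2 hR).unit).toMeasurableEquiv).symm
    _ = ENNReal.ofReal |(R ^ 3)⁻¹| * ∫⁻ x, f x := by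
        rw [Measure.map_addHaar_smul volume hR, lintegral_smul_measure, finrank_euclideanSpace_fin,
          smul_eq_mul]

/-- `|k·M|² = k²|M|²`. [folklore] -/
private theorem frobeniusNormSq_smul' (k : ℝ) (M : EuclideanSpace ℝ (Fin 3) →L[ℝ] EuclideanSpace ℝ (Fin 3)) :
    frobeniusNormSq (k • M) = k ^ 2 * frobeniusNormSq M := by
  simp [frobeniusNormSq, norm_smul, mul_pow, Finset.mul_sum, sq_abs]

/-- Chain rule for the rescaled, modulated profile. [folklore] -/
private theorem hasFDerivAt_smul_smul' {w : EuclideanSpace ℝ (Fin 3) → EuclideanSpace ℝ (Fin 3)}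
    (hwd : Differentiable ℝ w) (a c : ℝ) (x : EuclideanSpace ℝ (Fin 3)) :
    HasFDerivAt (fun y : EuclideanSpace ℝ (Fin 3) => a • w (c • y)) ((a * c) • fderiv ℝ w (c • x)) x := by
  have hw : HasFDerivAt w (fderiv ℝ w (c • x)) (c • x) := (hwd (c • x)).hasFDerivAt
  have hs : HasFDerivAt (fun y : EuclideanSpace ℝ (Fin 3) => c • y)
      (c • ContinuousLinearMap.id ℝ (EuclideanSpace ℝ (Fin 3))) x :=
    (hasFDerivAt_id x).const_smul c
  have h2 : HasFDerivAt (fun y : EuclideanSpace ℝ (Fin 3) => a • w (c • y))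
      (a • (fderiv ℝ w (c • x)).comp (c • ContinuousLinearMap.id ℝ (EuclideanSpace ℝ (Fin 3)))) x :=
    (hw.comp x hs).const_smul a
  refine h2.congr_fderiv ?_
  ext v i
  simp [smul_smul]

/-- **Energy of a rescaled, modulated profile**: `‖a·w(c·)‖₂² = a² c⁻³ e`. [folklore] -/
private theorem energy_scaled' (w : EuclideanSpace ℝ (Fin 3) → EuclideanSpace ℝ (Fin 3)) {e : ℝ}
    (heW : ∫⁻ x, ‖w x‖ₑ ^ 2 = ENNReal.ofReal e) (a : ℝ) {c : ℝ} (hc : 0 < c) :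
    energyOn Set.univ (fun x => a • w (c • x)) = ENNReal.ofReal (a ^ 2 * (c ^ 3)⁻¹ * e) := by
  unfold energyOn
  rw [Measure.restrict_univ]
  calc ∫⁻ x, ‖a • w (c • x)‖ₑ ^ 2 = ∫⁻ x, ‖a‖ₑ ^ 2 * ‖w (c • x)‖ₑ ^ 2 := by
        simp_rw [enorm_smul, mul_pow]
    _ = ‖a‖ₑ ^ 2 * ∫⁻ x, ‖w (c • x)‖ₑ ^ 2 :=
        lintegral_const_mul' _ _ (ENNReal.pow_ne_top enorm_ne_top)
    _ = ‖a‖ₑ ^ 2 * (ENNReal.ofReal |(c ^ 3)⁻¹| * ENNReal.ofReal e) := by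
        rw [lintegral_comp_smul' (fun y => ‖w y‖ₑ ^ 2) hc.ne', heW]
    _ = ENNReal.ofReal (a ^ 2 * (c ^ 3)⁻¹ * e) := by
        rw [Real.enorm_eq_ofReal_abs, ← ENNReal.ofReal_pow (abs_nonneg _),
          ← ENNReal.ofReal_mul (abs_nonneg _), ← ENNReal.ofReal_mul (by positivity)]
        congr 1
        rw [sq_abs, abs_of_pos (by positivity)]
        ring

/-- **Enstrophy of a rescaled, modulated profile**: `‖∇(a·w(c·))‖₂² = (ac)² c⁻³ ‖∇w‖₂²`. [folklore] -/
private theorem enstrophy_scaled' {w : EuclideanSpace ℝ (Fin 3) → EuclideanSpace ℝ (Fin 3)}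
    (hwd : Differentiable ℝ w) {z : ℝ}
    (hzW : ∫⁻ x, ENNReal.ofReal (frobeniusNormSq (fderiv ℝ w x)) = ENNReal.ofReal z) (a : ℝ) {c : ℝ}
    (hc : 0 < c) :
    enstrophyOn Set.univ (fun x => a • w (c • x)) = ENNReal.ofReal ((a * c) ^ 2 * ((c ^ 3)⁻¹ * z)) := by
  have hfd : ∀ x, fderiv ℝ (fun y : EuclideanSpace ℝ (Fin 3) => a • w (c • y)) x =
      (a * c) • fderiv ℝ w (c • x) :=
    fun x => (hasFDerivAt_smul_smul' hwd _ _ x).fderiv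
  unfold enstrophyOn
  rw [Measure.restrict_univ]
  simp_rw [hfd, frobeniusNormSq_smul', ENNReal.ofReal_mul (sq_nonneg _)]
  rw [lintegral_const_mul' _ _ ENNReal.ofReal_ne_top,
    lintegral_comp_smul' (fun y => ENNReal.ofReal (frobeniusNormSq (fderiv ℝ w y))) hc.ne', hzW,
    ← ENNReal.ofReal_mul (abs_nonneg _), abs_of_pos (by positivity)]

/-- `h(t) = 1 − t − t² > 0` on `[0, 1/2]`. [folklore] -/
private theorem hh_pos' {t : ℝ} (h0 : 0 ≤ t) (h1 : t ≤ 1 / 2) : 0 < 1 - t - t ^ 2 := by nlinarith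

/-- **Energy of the field** `u(t) = a(t)·w(c(t)·)`: `e·(1 − t − t²)` on `[0, 1/2]`.
[cite: Nguyen2022NSGlobalNoForce, (3.0.4) p. 18] -/
private theorem energy_U' (w : EuclideanSpace ℝ (Fin 3) → EuclideanSpace ℝ (Fin 3)) {e z : ℝ}
    (he : 0 < e) (hz : 0 < z) (heW : ∫⁻ x, ‖w x‖ₑ ^ 2 = ENNReal.ofReal e) {t : ℝ} (h0 : 0 ≤ t)
    (h1 : t ≤ 1 / 2) :
    energyOn Set.univ (fun x : EuclideanSpace ℝ (Fin 3) => Real.sqrt ((1 - t - t ^ 2) * Real.sqrt (e * (1 + 2 * t) / (z * (1 - t - t ^ 2))) ^ 3) • w (Real.sqrt (e * (1 + 2 * t) / (z * (1 - t - t ^ 2))) • x)) =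
      ENNReal.ofReal (e * (1 - t - t ^ 2)) := by
  have hh0 := hh_pos' h0 h1
  have hc2 : 0 < e * (1 + 2 * t) / (z * (1 - t - t ^ 2)) := by positivity
  set c : ℝ := Real.sqrt (e * (1 + 2 * t) / (z * (1 - t - t ^ 2))) with hc_def
  have hc : 0 < c := Real.sqrt_pos.2 hc2
  have hcsq : c ^ 2 = e * (1 + 2 * t) / (z * (1 - t - t ^ 2)) := Real.sq_sqrt hc2.le
  set a : ℝ := Real.sqrt ((1 - t - t ^ 2) * c ^ 3) with ha_def
  have hasq : a ^ 2 = (1 - t - t ^ 2) * c ^ 3 :=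
    Real.sq_sqrt (mul_nonneg hh0.le (pow_nonneg hc.le 3))
  rw [energy_scaled' w heW a hc]
  congr 1
  rw [hasq]
  field_simp

/-- **Enstrophy of the field**: `e·(1 + 2t)` on `[0, 1/2]`. [cite: Nguyen2022NSGlobalNoForce, (3.0.4) p. 18] -/
private theorem enstrophy_U' {w : EuclideanSpace ℝ (Fin 3) → EuclideanSpace ℝ (Fin 3)}
    (hwd : Differentiable ℝ w) {e z : ℝ} (he : 0 < e) (hz : 0 < z)
    (hzW : ∫⁻ x, ENNReal.ofReal (frobeniusNormSq (fderiv ℝ w x)) = ENNReal.ofReal z) {t : ℝ}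
    (h0 : 0 ≤ t) (h1 : t ≤ 1 / 2) :
    enstrophyOn Set.univ (fun x : EuclideanSpace ℝ (Fin 3) => Real.sqrt ((1 - t - t ^ 2) * Real.sqrt (e * (1 + 2 * t) / (z * (1 - t - t ^ 2))) ^ 3) • w (Real.sqrt (e * (1 + 2 * t) / (z * (1 - t - t ^ 2))) • x)) =
      ENNReal.ofReal (e * (1 + 2 * t)) := by
  have hh0 := hh_pos' h0 h1
  have hc2 : 0 < e * (1 + 2 * t) / (z * (1 - t - t ^ 2)) := by positivity
  set c : ℝ := Real.sqrt (e * (1 + 2 * t) / (z * (1 - t - t ^ 2))) with hc_def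
  have hc : 0 < c := Real.sqrt_pos.2 hc2
  have hcsq : c ^ 2 = e * (1 + 2 * t) / (z * (1 - t - t ^ 2)) := Real.sq_sqrt hc2.le
  set a : ℝ := Real.sqrt ((1 - t - t ^ 2) * c ^ 3) with ha_def
  have hasq : a ^ 2 = (1 - t - t ^ 2) * c ^ 3 :=
    Real.sq_sqrt (mul_nonneg hh0.le (pow_nonneg hc.le 3))
  rw [enstrophy_scaled' hwd hzW a hc]
  congr 1
  have h3 : c ^ 2 * (z * (1 - t - t ^ 2)) = e * (1 + 2 * t) := by
    rw [hcsq]; field_simp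
  rw [mul_pow, hasq]
  field_simp
  nlinarith [h3, hc, hh0]

/-- The time set of (3.0.1) with `T = 1/2` is `[0, 1/2)`. [folklore] -/
private theorem timeSet_eq' :
    {s : ℝ | 0 ≤ s ∧ ENNReal.ofReal s < ENNReal.ofReal (1 / 2)} = Set.Ico (0 : ℝ) (1 / 2) := by
  ext s
  simp only [Set.mem_setOf_eq, Set.mem_Ico, ENNReal.ofReal_lt_ofReal_iff (by norm_num : (0 : ℝ) < 1 / 2)]

/-- `(e h)′ = −e(1 + 2t)`. [folklore] -/
private theorem hasDerivAt_e_hh' (e t : ℝ) :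
    HasDerivAt (fun s => e * (1 - s - s ^ 2)) (-1 * (e * (1 + 2 * t))) t := by
  have h := (((hasDerivAt_const t (1 : ℝ)).sub (hasDerivAt_id' t)).sub
    ((hasDerivAt_id' t).mul (hasDerivAt_id' t))).const_mul e
  refine (h.congr_deriv (by ring)).congr_of_eventuallyEq (Filter.Eventually.of_forall fun s => ?_)
  simp only [Pi.sub_apply, Pi.mul_apply]; ring

/-- `(e (1 + 2t))′ = 2e`. [folklore] -/
private theorem hasDerivAt_e_lin' (e t : ℝ) : HasDerivAt (fun s => e * (1 + 2 * s)) (2 * e) t := by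
  have h := (((hasDerivAt_id' t).const_mul (2 : ℝ)).const_add (1 : ℝ)).const_mul e
  exact h.congr_deriv (by ring)

/-- **The field obeys (3.0.1)** on `ℝ³ × [0, 1/2)` with `C₀ = 1`, `C₁ = 2/e²`.
[cite: Nguyen2022NSGlobalNoForce, Thm 3.0.1 eq. (3.0.1) p. 17] -/
private theorem laws_U' {w : EuclideanSpace ℝ (Fin 3) → EuclideanSpace ℝ (Fin 3)}
    (hwd : Differentiable ℝ w) {e z : ℝ} (he : 0 < e) (hz : 0 < z)
    (heW : ∫⁻ x, ‖w x‖ₑ ^ 2 = ENNReal.ofReal e)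
    (hzW : ∫⁻ x, ENNReal.ofReal (frobeniusNormSq (fderiv ℝ w x)) = ENNReal.ofReal z) :
    Laws301 Set.univ (ENNReal.ofReal (1 / 2)) 1 (2 / e ^ 2)
      (fun (t : ℝ) (x : EuclideanSpace ℝ (Fin 3)) =>
      Real.sqrt ((1 - t - t ^ 2) * Real.sqrt (e * (1 + 2 * t) / (z * (1 - t - t ^ 2))) ^ 3) •
        w (Real.sqrt (e * (1 + 2 * t) / (z * (1 - t - t ^ 2))) • x)) := by
  intro t ht0 htT
  have ht1 : t < 1 / 2 := (ENNReal.ofReal_lt_ofReal_iff (by norm_num)).1 htT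
  beta_reduce
  rw [timeSet_eq']
  refine ⟨by rw [energy_U' w he hz heW ht0 ht1.le]; exact ENNReal.ofReal_ne_top,
    by rw [enstrophy_U' hwd he hz hzW ht0 ht1.le]; exact ENNReal.ofReal_ne_top, ?_, ⟨2 * e, ?_, ?_⟩⟩
  · rw [enstrophy_U' hwd he hz hzW ht0 ht1.le, ENNReal.toReal_ofReal (by positivity)]
    refine (hasDerivAt_e_hh' e t).hasDerivWithinAt.congr_of_mem (fun s hs => ?_) ⟨ht0, ht1⟩
    rw [energy_U' w he hz heW hs.1 hs.2.le,
      ENNReal.toReal_ofReal (mul_nonneg he.le (hh_pos' hs.1 hs.2.le).le)]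
  · refine (hasDerivAt_e_lin' e t).hasDerivWithinAt.congr_of_mem (fun s hs => ?_) ⟨ht0, ht1⟩
    rw [enstrophy_U' hwd he hz hzW hs.1 hs.2.le, ENNReal.toReal_ofReal (by nlinarith [hs.1])]
  · rw [enstrophy_U' hwd he hz hzW ht0 ht1.le, ENNReal.toReal_ofReal (by positivity)]
    have h1 : (1 : ℝ) ≤ (1 + 2 * t) ^ 3 := one_le_pow₀ (by linarith)
    rw [show 2 / e ^ 2 * (e * (1 + 2 * t)) ^ 3 = 2 * e * (1 + 2 * t) ^ 3 by
      field_simp]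
    nlinarith [h1]

/-- **(3.0.2) fails for the field**: `E + Z = e(2 + t − t²)` is larger at `t = 1/4` than at `t = 0`.
[cite: Nguyen2022NSGlobalNoForce, Thm 3.0.1 eq. (3.0.2) p. 17] -/
private theorem not_monotone_U' {w : EuclideanSpace ℝ (Fin 3) → EuclideanSpace ℝ (Fin 3)}
    (hwd : Differentiable ℝ w) {e z : ℝ} (he : 0 < e) (hz : 0 < z)
    (heW : ∫⁻ x, ‖w x‖ₑ ^ 2 = ENNReal.ofReal e)
    (hzW : ∫⁻ x, ENNReal.ofReal (frobeniusNormSq (fderiv ℝ w x)) = ENNReal.ofReal z) :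
    ¬ Monotone302 Set.univ (ENNReal.ofReal (1 / 2))
      (fun (t : ℝ) (x : EuclideanSpace ℝ (Fin 3)) =>
      Real.sqrt ((1 - t - t ^ 2) * Real.sqrt (e * (1 + 2 * t) / (z * (1 - t - t ^ 2))) ^ 3) •
        w (Real.sqrt (e * (1 + 2 * t) / (z * (1 - t - t ^ 2))) • x)) := by
  intro hA
  unfold Monotone302 at hA
  rw [timeSet_eq'] at hA
  have key := hA (show (0 : ℝ) ∈ Set.Ico (0 : ℝ) (1 / 2) by norm_num)
    (show (1 / 4 : ℝ) ∈ Set.Ico (0 : ℝ) (1 / 2) by norm_num) (by norm_num)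
  beta_reduce at key
  rw [energy_U' w he hz heW le_rfl (by norm_num), enstrophy_U' hwd he hz hzW le_rfl (by norm_num),
    energy_U' w he hz heW (by norm_num) (by norm_num), enstrophy_U' hwd he hz hzW (by norm_num) (by norm_num),
    ← ENNReal.ofReal_add (by positivity) (by positivity),
    ← ENNReal.ofReal_add (by positivity) (by positivity),
    ENNReal.ofReal_le_ofReal_iff (by positivity)] at key
  nlinarith

/-- Theorem 3.0.1 as printed fails for the field built on ANY differentiable profile `w` of finite
positive energy `e` and enstrophy `z`: `Ω = ℝ³`, `T = 1/2`, `C₀ = 1`, `C₁ = 2/e²`.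
[cite: Nguyen2022NSGlobalNoForce, Thm 3.0.1 p. 17] -/
private theorem step5_false_of_profile {w : EuclideanSpace ℝ (Fin 3) → EuclideanSpace ℝ (Fin 3)}
    (hwd : Differentiable ℝ w) {e z : ℝ} (he : 0 < e) (hz : 0 < z)
    (heW : ∫⁻ x, ‖w x‖ₑ ^ 2 = ENNReal.ofReal e)
    (hzW : ∫⁻ x, ENNReal.ofReal (frobeniusNormSq (fderiv ℝ w x)) = ENNReal.ofReal z) :
    ¬ Step5_Theorem301 := fun h =>
  not_monotone_U' hwd he hz heW hzW (h Set.univ isOpen_univ isConnected_univ _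
    (ENNReal.ofReal_pos.2 (by norm_num)) 1 (2 / e ^ 2) one_pos (by positivity) _ (laws_U' hwd he hz heW hzW))

/-- A linear map with zero Frobenius norm is zero. [folklore] -/
private theorem eq_zero_of_frobeniusNormSq_eq_zero'
    {M : EuclideanSpace ℝ (Fin 3) →L[ℝ] EuclideanSpace ℝ (Fin 3)} (h : frobeniusNormSq M = 0) : M = 0 := by
  unfold frobeniusNormSq at h
  have h' := (Finset.sum_eq_zero_iff_of_nonneg fun i _ => sq_nonneg _).1 h
  have hb : ∀ i, M ((stdOrthonormalBasis ℝ (EuclideanSpace ℝ (Fin 3))) i) = 0 := fun i => by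
    have := h' i (Finset.mem_univ i)
    rwa [sq_eq_zero_iff, norm_eq_zero] at this
  have hl : (M : EuclideanSpace ℝ (Fin 3) →ₗ[ℝ] EuclideanSpace ℝ (Fin 3)) =
      ((0 : EuclideanSpace ℝ (Fin 3) →L[ℝ] EuclideanSpace ℝ (Fin 3)) :
        EuclideanSpace ℝ (Fin 3) →ₗ[ℝ] EuclideanSpace ℝ (Fin 3)) :=
    (stdOrthonormalBasis ℝ (EuclideanSpace ℝ (Fin 3))).toBasis.ext fun i => by simpa using hb i
  exact ContinuousLinearMap.coe_injective hl

/-- A smooth compactly supported NON-CONSTANT profile has finite positive energy and enstrophy: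
there are reals `e, z > 0` with `‖w‖₂² = e`, `‖∇w‖₂² = z` (in `ℝ≥0∞`). [folklore] -/
private theorem profile_energy_enstrophy {w : EuclideanSpace ℝ (Fin 3) → EuclideanSpace ℝ (Fin 3)}
    (hw : ContDiff ℝ ((⊤ : ℕ∞) : WithTop ℕ∞) w) (hcs : HasCompactSupport w)
    {x₀ x₁ : EuclideanSpace ℝ (Fin 3)} (h01 : w x₀ ≠ w x₁) :
    ∃ e z : ℝ, 0 < e ∧ 0 < z ∧ (∫⁻ x, ‖w x‖ₑ ^ 2) = ENNReal.ofReal e ∧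
      (∫⁻ x, ENNReal.ofReal (frobeniusNormSq (fderiv ℝ w x))) = ENNReal.ofReal z := by
  have hwd : Differentiable ℝ w := hw.differentiable (WithTop.coe_ne_zero.2 ENat.top_ne_zero)
  have hcont : Continuous w := hw.continuous
  have hcfrob : Continuous fun x => frobeniusNormSq (fderiv ℝ w x) := by
    have hc : Continuous (fderiv ℝ w) := hw.continuous_fderiv (by simp)
    unfold frobeniusNormSq
    exact continuous_finsetSum _ fun i _ => ((hc.clm_apply continuous_const).norm).pow 2
  -- finiteness
  have heTop : (∫⁻ x, ‖w x‖ₑ ^ 2) < ⊤ := by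
    have hcs2 : HasCompactSupport ((fun v : EuclideanSpace ℝ (Fin 3) => ‖v‖ ^ 2) ∘ w) :=
      hcs.comp_left (by simp)
    have hint : Integrable (fun x => ‖w x‖ ^ 2) :=
      ((hcont.norm).pow 2).integrable_of_hasCompactSupport hcs2
    have h := hasFiniteIntegral_iff_enorm.1 hint.hasFiniteIntegral
    refine lt_of_eq_of_lt (lintegral_congr fun x => ?_) h
    rw [Real.enorm_eq_ofReal (sq_nonneg _), ENNReal.ofReal_pow (norm_nonneg _), ofReal_norm]
  have hzTop : (∫⁻ x, ENNReal.ofReal (frobeniusNormSq (fderiv ℝ w x))) < ⊤ := by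
    have hcs2 : HasCompactSupport (frobeniusNormSq ∘ fderiv ℝ w) :=
      (hcs.fderiv (𝕜 := ℝ)).comp_left frobeniusNormSq_zero
    have hint : Integrable (fun x => frobeniusNormSq (fderiv ℝ w x)) :=
      hcfrob.integrable_of_hasCompactSupport hcs2
    have h := hasFiniteIntegral_iff_enorm.1 hint.hasFiniteIntegral
    refine lt_of_eq_of_lt (lintegral_congr fun x => ?_) h
    rw [Real.enorm_eq_ofReal (frobeniusNormSq_nonneg _)]
  -- positivity of the enstrophy: else `∇w ≡ 0`, `w` constant, contradicting `w x₀ ≠ w x₁`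
  have hzPos : 0 < ∫⁻ x, ENNReal.ofReal (frobeniusNormSq (fderiv ℝ w x)) := by
    rw [pos_iff_ne_zero]
    intro hz0
    have hmeas : Measurable fun x => ENNReal.ofReal (frobeniusNormSq (fderiv ℝ w x)) :=
      hcfrob.measurable.ennreal_ofReal
    have hae := (lintegral_eq_zero_iff hmeas).1 hz0
    have hcont2 : Continuous fun x => ENNReal.ofReal (frobeniusNormSq (fderiv ℝ w x)) :=
      ENNReal.continuous_ofReal.comp hcfrob
    have hzero := (Continuous.ae_eq_iff_eq volume hcont2 continuous_const).1 hae
    have hfd : ∀ x, fderiv ℝ w x = 0 := fun x => by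
      have hx : ENNReal.ofReal (frobeniusNormSq (fderiv ℝ w x)) = 0 := by
        simpa using congrFun hzero x
      exact eq_zero_of_frobeniusNormSq_eq_zero'
        (le_antisymm (ENNReal.ofReal_eq_zero.1 hx) (frobeniusNormSq_nonneg _))
    exact h01 (is_const_of_fderiv_eq_zero hwd hfd x₀ x₁)
  -- positivity of the energy: else `w ≡ 0`, again contradicting `w x₀ ≠ w x₁`
  have hePos : 0 < ∫⁻ x, ‖w x‖ₑ ^ 2 := by
    rw [pos_iff_ne_zero]
    intro he0
    have hcont2 : Continuous fun x => ‖w x‖ₑ ^ 2 := (ENNReal.continuous_pow 2).comp hcont.enorm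
    have hmeas : Measurable fun x => ‖w x‖ₑ ^ 2 := hcont2.measurable
    have hae := (lintegral_eq_zero_iff hmeas).1 he0
    have hzero := (Continuous.ae_eq_iff_eq volume hcont2 continuous_const).1 hae
    have hw0 : ∀ x, w x = 0 := fun x => by
      have hx : ‖w x‖ₑ ^ 2 = 0 := by simpa using congrFun hzero x
      have : ‖w x‖ₑ = 0 := pow_eq_zero_iff two_ne_zero |>.1 hx
      simpa using this
    exact h01 (by rw [hw0 x₀, hw0 x₁])
  refine ⟨(∫⁻ x, ‖w x‖ₑ ^ 2).toReal, (∫⁻ x, ENNReal.ofReal (frobeniusNormSq (fderiv ℝ w x))).toReal,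
    ENNReal.toReal_pos hePos.ne' heTop.ne, ENNReal.toReal_pos hzPos.ne' hzTop.ne,
    (ENNReal.ofReal_toReal heTop.ne).symm, (ENNReal.ofReal_toReal hzTop.ne).symm⟩

/-- **THEOREM 3.0.1 (p. 17), as printed, is false**: the laws (3.0.1) do not force (3.0.2).  Witness
`Ω = ℝ³`, `T = 1/2`, `C₀ = 1`, `C₁ = 2/e²`, `u(t,x) = a(t) w(c(t) x)` on the bump profile
`w = χ · e₀` (`χ ≡ 1` on the unit ball, supported in radius `2`; `w(0) = e₀ ≠ 0 = w(3e₀)`).  Twin of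
the summit-side `…Theorems.Nguyen2022.not_Step5_Theorem301` (same witness, profile and its two moments
as parameters of the private lemmas). [cite: Nguyen2022NSGlobalNoForce, Thm 3.0.1 p. 17] -/
theorem step5_Theorem301_false : ¬ Step5_Theorem301 := by
  -- the bump profile `χ · e₀`, `χ = ⟨1, 2⟩ : ContDiffBump 0`
  obtain ⟨e, z, he, hz, heW, hzW⟩ := profile_energy_enstrophy
    (w := fun x => ((⟨1, 2, one_pos, one_lt_two⟩ : ContDiffBump (0 : EuclideanSpace ℝ (Fin 3))) x) •
      EuclideanSpace.single (0 : Fin 3) (1 : ℝ))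
    (x₀ := 0) (x₁ := EuclideanSpace.single (0 : Fin 3) (3 : ℝ))
    ((⟨1, 2, one_pos, one_lt_two⟩ : ContDiffBump (0 : EuclideanSpace ℝ (Fin 3))).contDiff.smul
      contDiff_const)
    ((⟨1, 2, one_pos, one_lt_two⟩ : ContDiffBump (0 : EuclideanSpace ℝ (Fin 3))).hasCompactSupport.smul_right)
    (by
      have h1 : ((⟨1, 2, one_pos, one_lt_two⟩ : ContDiffBump (0 : EuclideanSpace ℝ (Fin 3))) :
          EuclideanSpace ℝ (Fin 3) → ℝ) 0 = 1 :=
        ContDiffBump.one_of_mem_closedBall _ (Metric.mem_closedBall_self (by norm_num))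
      have h3 : ((⟨1, 2, one_pos, one_lt_two⟩ : ContDiffBump (0 : EuclideanSpace ℝ (Fin 3))) :
          EuclideanSpace ℝ (Fin 3) → ℝ) (EuclideanSpace.single (0 : Fin 3) (3 : ℝ)) = 0 := by
        refine ContDiffBump.zero_of_le_dist _ ?_
        rw [dist_zero_right]
        norm_num
      simp only [h1, h3, one_smul, zero_smul]
      rw [ne_eq, ← norm_eq_zero]
      simp)
  exact step5_false_of_profile
    ((((⟨1, 2, one_pos, one_lt_two⟩ : ContDiffBump (0 : EuclideanSpace ℝ (Fin 3))).contDiff.smul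
      contDiff_const).differentiable (WithTop.coe_ne_zero.2 ENat.top_ne_zero))) he hz heW hzW

/-- **`Step6_Section4` holds — VACUOUSLY** (typed `Prop` unchanged): the §4 inference
«Theorem 3.0.1 ⟹ global strong solutions for every datum» is true as an implication because
Theorem 3.0.1 as printed is false (`step5_Theorem301_false`).  NOT the printed §4 argument
succeeding, and no statement about Theorem 1.0.1.
[cite: Nguyen2022NSGlobalNoForce, §4 Steps A–C pp. 20–23; Cor 3.0.2 p. 20; Thm 2.3.8 p. 13] -/
theorem Step6_Section4_holds : Step6_Section4 := fun h => (step5_Theorem301_false h).elim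

end Literature.Claims.NS.Nguyen2022

/-! ### Zhong 2026 — `Step_27_of_loc` (proof of Lemma 6.1 p.8), antecedent «|∇ω̂|² ≥ ⅓|∇ψ|²» (local form) -/

namespace Literature.Claims.NS.Zhong2026

open MeasureTheory Metric Filter Topology
open Literature.Analysis.FluidPDE Literature.Analysis.FluidPDE.Tao2016
open Literature.Claims.NS.Chishtie2025 (e)

/-! Witness A of the summit-side refutation `…Theorems.Zhong2026.not_Step_geom_ge_loc` — the localised
planar shear `v = curl (χ·Aₐ)`, `Aₐ(y) = (0, 0, −(y₀²/2 + y₀³/6))`, with vorticity `(0, 0, 1 + y₀)` on the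
unit ball — rebuilt without auxiliary definitions: the fields are written as lambdas, the bump `χ` is a
parameter of the private lemmas, and the final contradiction is derived for ANY field whose vorticity
agrees with `(1 + y₀) e₂` near the origin.  Twins of the summit-side lemmas (and of
`…Theorems.Santak2026.lintegral_iteratedFDeriv_sq_lt_top`). -/

/-- All `L²` Sobolev norms of a smooth compactly supported field are finite. [folklore] -/
private theorem lintegral_iteratedFDeriv_sq_lt_top' {f : E3 → E3} (hf : ContDiff ℝ ∞ f)
    (hs : HasCompactSupport f) (n : ℕ) : ∫⁻ x, ‖iteratedFDeriv ℝ n f x‖ₑ ^ 2 < ⊤ := by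
  have hg : Continuous (iteratedFDeriv ℝ n f) :=
    hf.continuous_iteratedFDeriv (m := n) (by exact_mod_cast le_top)
  have hcont : Continuous fun x => ‖iteratedFDeriv ℝ n f x‖ * ‖iteratedFDeriv ℝ n f x‖ :=
    hg.norm.mul hg.norm
  have hsupp : HasCompactSupport fun x => ‖iteratedFDeriv ℝ n f x‖ * ‖iteratedFDeriv ℝ n f x‖ :=
    (hs.iteratedFDeriv (𝕜 := ℝ) n).norm.mul_right
  have hint := (hcont.integrable_of_hasCompactSupport (μ := volume) hsupp).lintegral_lt_top
  refine lt_of_le_of_lt (le_of_eq (lintegral_congr fun x => ?_)) hint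
  rw [ENNReal.ofReal_mul (norm_nonneg _), ofReal_norm, sq]

/-- `χ A = A` near every point of the ball where the bump `χ ≡ 1`. [folklore] -/
private theorem smul_eventuallyEq' (χ : ContDiffBump (0 : E3)) (A : E3 → E3) {y : E3}
    (hy : y ∈ ball (0 : E3) χ.rIn) : (fun x => χ x • A x) =ᶠ[𝓝 y] A := by
  filter_upwards [χ.eventuallyEq_one_of_mem_ball hy] with x hx
  simp [hx]

/-- `curl (χ A) = curl A` on that ball. [folklore] -/
private theorem curl_smul_eq' (χ : ContDiffBump (0 : E3)) (A : E3 → E3) {y : E3}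
    (hy : y ∈ ball (0 : E3) χ.rIn) : curl (fun x => χ x • A x) y = curl A y := by
  rw [curl_eq_curlCLM, (smul_eventuallyEq' χ A hy).fderiv_eq, ← curl_eq_curlCLM]

/-- A localised potential gives a class datum: `curl (χ A)` is smooth, compactly supported, divergence
free, with all `L²` Sobolev norms finite. [folklore] -/
private theorem isDatum_curl_smul' (χ : ContDiffBump (0 : E3)) {A : E3 → E3} (hA : ContDiff ℝ ∞ A) :
    Chae2007.IsDatum (curl fun x => χ x • A x) := by
  have hs : ContDiff ℝ ∞ fun x => χ x • A x := χ.contDiff.smul hA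
  have hc : ContDiff ℝ ∞ (curl fun x => χ x • A x) :=
    contDiff_curl (n := (⊤ : ℕ∞)) (by exact_mod_cast hs)
  have hk : HasCompactSupport (curl fun x => χ x • A x) :=
    hasCompactSupport_curl χ.hasCompactSupport.smul_right
  refine ⟨hc, fun x => ?_, fun n => lintegral_iteratedFDeriv_sq_lt_top' hc hk n⟩
  show VectorCalculus.divergence (curl fun x => χ x • A x) x = 0
  exact divergence_curl_eq_zero_holds _ (hs.of_le (by norm_cast)) x

/-- The witness-A potential `Aₐ(y) = −(y₀²/2 + y₀³/6) e₂` is smooth. [folklore] -/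
private theorem contDiff_potA' : ContDiff ℝ ∞ fun y : E3 =>
    (-((1 / 2 : ℝ) * (y 0 * y 0) + (1 / 6 : ℝ) * (y 0 * y 0 * y 0))) • e 2 := by
  show ContDiff ℝ ∞ fun y : E3 =>
    (-((1 / 2 : ℝ) * ((EuclideanSpace.proj (0 : Fin 3) : E3 →L[ℝ] ℝ) y *
        (EuclideanSpace.proj (0 : Fin 3) : E3 →L[ℝ] ℝ) y) +
      (1 / 6 : ℝ) * ((EuclideanSpace.proj (0 : Fin 3) : E3 →L[ℝ] ℝ) y *
        (EuclideanSpace.proj (0 : Fin 3) : E3 →L[ℝ] ℝ) y *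
        (EuclideanSpace.proj (0 : Fin 3) : E3 →L[ℝ] ℝ) y))) • e 2
  fun_prop

/-- `curl Aₐ = Sₐ`, the planar shear `(y₀ + y₀²/2) e₁`. [folklore] -/
private theorem curl_potA' (y : E3) :
    curl (fun y : E3 => (-((1 / 2 : ℝ) * (y 0 * y 0) + (1 / 6 : ℝ) * (y 0 * y 0 * y 0))) • e 2) y =
      (y 0 + (1 / 2 : ℝ) * (y 0 * y 0)) • e 1 := by
  set P0 : E3 →L[ℝ] ℝ := EuclideanSpace.proj (0 : Fin 3) with hP0
  have hd : HasFDerivAt (fun y : E3 => (-((1 / 2 : ℝ) * (y 0 * y 0) + (1 / 6 : ℝ) * (y 0 * y 0 * y 0))) • e 2)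
      ((-((1 / 2 : ℝ) • (P0 y • P0 + P0 y • P0) +
          (1 / 6 : ℝ) • ((P0 y * P0 y) • P0 + P0 y • (P0 y • P0 + P0 y • P0)))).smulRight (e 2)) y := by
    show HasFDerivAt (fun y : E3 =>
      (-((1 / 2 : ℝ) * (P0 y * P0 y) + (1 / 6 : ℝ) * (P0 y * P0 y * P0 y))) • e 2) _ y
    exact (((P0.hasFDerivAt.mul P0.hasFDerivAt).const_mul (1 / 2 : ℝ)).add
      (((P0.hasFDerivAt.mul P0.hasFDerivAt).mul P0.hasFDerivAt).const_mul (1 / 6 : ℝ))).neg.smul_const (e 2)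
  simp only [curl]
  rw [hd.fderiv]
  ext i; fin_cases i <;> simp [e, hP0]
  ring

/-- `curl Sₐ = Wₐ`: the vorticity of witness A is `(1 + y₀) e₂`. [folklore] -/
private theorem curl_shearA' (y : E3) :
    curl (fun y : E3 => (y 0 + (1 / 2 : ℝ) * (y 0 * y 0)) • e 1) y = (1 + y 0) • e 2 := by
  set P0 : E3 →L[ℝ] ℝ := EuclideanSpace.proj (0 : Fin 3) with hP0
  have hd : HasFDerivAt (fun y : E3 => (y 0 + (1 / 2 : ℝ) * (y 0 * y 0)) • e 1)
      ((P0 + (1 / 2 : ℝ) • (P0 y • P0 + P0 y • P0)).smulRight (e 1)) y := by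
    show HasFDerivAt (fun y : E3 => (P0 y + (1 / 2 : ℝ) * (P0 y * P0 y)) • e 1) _ y
    exact (P0.hasFDerivAt.add ((P0.hasFDerivAt.mul P0.hasFDerivAt).const_mul (1 / 2 : ℝ))).smul_const (e 1)
  simp only [curl]
  rw [hd.fderiv]
  ext i; fin_cases i <;> simp [e, hP0]
  ring

/-- **Witness A exists in the class**: a class datum whose vorticity is `(1 + y₀) e₂` near the origin
(`v = curl (χ Aₐ)` with `χ ≡ 1` on the unit ball). [folklore] -/
private theorem exists_witnessA' :
    ∃ v : E3 → E3, Chae2007.IsDatum v ∧ curl v =ᶠ[𝓝 (0 : E3)] fun y : E3 => (1 + y 0) • e 2 := by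
  let χ : ContDiffBump (0 : E3) := ⟨1, 2, one_pos, one_lt_two⟩
  refine ⟨curl fun x => χ x •
      ((-((1 / 2 : ℝ) * (x 0 * x 0) + (1 / 6 : ℝ) * (x 0 * x 0 * x 0))) • e 2),
    isDatum_curl_smul' χ contDiff_potA', ?_⟩
  -- on the unit ball the datum is the shear, hence its curl is the vorticity of witness A
  have hball : ∀ y ∈ ball (0 : E3) χ.rIn, curl (fun x => χ x •
      ((-((1 / 2 : ℝ) * (x 0 * x 0) + (1 / 6 : ℝ) * (x 0 * x 0 * x 0))) • e 2)) y =
        (y 0 + (1 / 2 : ℝ) * (y 0 * y 0)) • e 1 := fun y hy => by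
    rw [curl_smul_eq' χ _ hy, curl_potA']
  filter_upwards [ball_mem_nhds (0 : E3) χ.rIn_pos] with y hy
  have h : (curl fun x => χ x •
      ((-((1 / 2 : ℝ) * (x 0 * x 0) + (1 / 6 : ℝ) * (x 0 * x 0 * x 0))) • e 2)) =ᶠ[𝓝 y]
        fun z : E3 => (z 0 + (1 / 2 : ℝ) * (z 0 * z 0)) • e 1 := by
    filter_upwards [isOpen_ball.mem_nhds hy] with z hz using hball z hz
  rw [curl_eq_curlCLM, h.fderiv_eq, ← curl_eq_curlCLM, curl_shearA']

/-- **The local constraint «|∇ω̂|² ≥ ⅓|∇ψ|²» fails at the origin for every field whose vorticity is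
`(1 + y₀) e₂` nearby**: there `ω̂ ≡ e₂` (so `|∇ω̂|²(0) = 0`) while `ψ = log(1 + y₀)` has
`∇ψ(0) = e₀ ≠ 0`. [cite: Zhong2026, proof of Lemma 6.1 p.8 l.15–21] -/
private theorem not_geom_ge_of_curl_eventuallyEq' {v : E3 → E3}
    (hv : curl v =ᶠ[𝓝 (0 : E3)] fun y : E3 => (1 + y 0) • e 2) :
    curl v 0 ≠ 0 ∧ ¬ (1 / 3 * ‖gpsi (curl v) 0‖ ^ 2 ≤ gradDirSq (curl v) 0) := by
  set P0 : E3 →L[ℝ] ℝ := EuclideanSpace.proj (0 : Fin 3) with hP0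
  have hP0y : ∀ y : E3, P0 y = y 0 := fun y => rfl
  have h0 : curl v 0 = e 2 := by
    rw [hv.eq_of_nhds]; simp
  have hne : curl v 0 ≠ 0 := by
    rw [h0]; intro h
    have := congrArg (fun w : E3 => w 2) h
    simp [e] at this
  have hlt : ∀ᶠ y in 𝓝 (0 : E3), (-1 : ℝ) < y 0 := by
    have h : ContinuousAt (fun y : E3 => P0 y) 0 := P0.continuous.continuousAt
    have := continuousAt_const.eventually_lt h (by simp [hP0y] : (-1 : ℝ) < P0 0)
    simpa [hP0y] using this
  have hnorm : ∀ y : E3, (-1 : ℝ) < y 0 → ‖(1 + y 0) • e 2‖ = 1 + y 0 := fun y hy => by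
    rw [norm_smul, Real.norm_eq_abs, abs_of_pos (by linarith)]
    simp [e]
  have hdir : dirField (curl v) =ᶠ[𝓝 (0 : E3)] fun _ => e 2 := by
    filter_upwards [hv, hlt] with y hy hy1
    rw [dirField, hy, hnorm y hy1, smul_smul, inv_mul_cancel₀ (by linarith), one_smul]
  have hgrad : gradDirSq (curl v) 0 = 0 := by
    rw [gradDirSq, hdir.fderiv_eq]
    simp
  have hpsi : psi (curl v) =ᶠ[𝓝 (0 : E3)] fun y => Real.log (1 + P0 y) := by
    filter_upwards [hv, hlt] with y hy hy1
    rw [psi, hy, hnorm y hy1, hP0y]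
  have hfd : fderiv ℝ (psi (curl v)) 0 = P0 := by
    rw [hpsi.fderiv_eq]
    have h : HasFDerivAt (fun y : E3 => Real.log (1 + P0 y)) ((1 + P0 0)⁻¹ • P0) 0 :=
      (P0.hasFDerivAt.const_add 1).log (by simp [hP0y])
    rw [h.fderiv]; simp [hP0y]
  have hgpsi : gpsi (curl v) 0 ≠ 0 := by
    intro h
    have h1 : (InnerProductSpace.toDual ℝ E3).symm (fderiv ℝ (psi (curl v)) 0) = 0 := h
    rw [hfd] at h1
    have h2 : P0 = 0 := by simpa using h1
    have := congrArg (fun L : E3 →L[ℝ] ℝ => L (e 0)) h2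
    simp [e, hP0y] at this
  refine ⟨hne, ?_⟩
  rw [hgrad]; intro h
  have : ‖gpsi (curl v) 0‖ = 0 := by nlinarith [norm_nonneg (gpsi (curl v) 0)]
  exact hgpsi (norm_eq_zero.mp this)

/-- **«|∇ω̂|² ≥ ⅓|∇ψ|²» (proof of Lemma 6.1, p.8 l.15–21; pointwise where ω(x) ≠ 0) is false as typed**:
witness A, the localised planar shear with vorticity `(0, 0, 1 + y₀)` on the unit ball — at the origin
`|∇ω̂|² = 0` and `∇ψ = e₀ ≠ 0`.  Twin of the summit-side `…Theorems.Zhong2026.not_Step_geom_ge_loc`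
(same witness). [cite: Zhong2026, proof of Lemma 6.1 p.8 l.15–21] -/
theorem step_geom_ge_loc_false : ¬ Step_geom_ge_loc := fun h => by
  obtain ⟨v, hv, hcurl⟩ := exists_witnessA'
  obtain ⟨hne, hnot⟩ := not_geom_ge_of_curl_eventuallyEq' hcurl
  exact hnot (h v hv 0 hne)

/-- **`Step_27_of_loc` holds — VACUOUSLY** (typed `Prop` unchanged): `Step_21_loc → Step_geom_ge_loc →
Step_27` is true as an implication because its second antecedent is false (`step_geom_ge_loc_false`).
NOT the printed Lemma 6.1 inference succeeding, and no statement about (27).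
[cite: Zhong2026, proof of Lemma 6.1 p.8 l.13–22] -/
theorem Step_27_of_loc_holds : Step_27_of_loc := fun _ hge => (step_geom_ge_loc_false hge).elim

end Literature.Claims.NS.Zhong2026

end
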